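import Literature.MathematicalPhysics.QuantumFieldTheory.Volkov2016.OnShellDenominatorCoefficients
import Literature.MathematicalPhysics.QuantumFieldTheory.Volkov2016.RayConvergenceCriterion
import Literature.MathematicalPhysics.QuantumFieldTheory.Borinsky2020.SecondSymanzikPermutahedron
import HarnessLib

/-!
# Volkov 2016 (ЖЭТФ 149, 1164 = JETP 122, 1008) §5.2: the monomials of `V·z_e − S` made exact, «S − V z_e по порядку не превосходит δ²V» and «W/V ≍ δ²» along the IR vector — PROVED for every edge list under the abstract form of the QED hypotheses

independent recomputation; certified where stated, statistical where stated; no new-physics claim.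

CITATION HEADER (venture `QEDPrecision`, cell `pub-qed`, track TROPICAL seat V3a = `pub-qed-trop-v3-lit-1` gen 30; VALUE-FREE: statements
about the spanning-tree polynomial `V`, the separating-2-tree polynomial `S` and `W = S − V·z_e` of an ARBITRARY finite edge list with
two marked vertices and a marked line set, along an ARBITRARY two-level weight vector — no Feynman integrand, no constant, nothing per
Set V family or word). Third file of the ЖЭТФ §5.2 group: `OnShellDenominatorCoefficients.lean` (p394119: the SIGN of the coefficients of
`W`, by the injection 2-tree ↦ (1-tree, electron line)) and `OneTreePolynomialRayOrder.lean` (p394173/p394342: the ORDER of `V` along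
`𝟙_A + 𝟙_B` and along any integer ray) typed the first two printed statements of the §5.2 table; this file types the remaining
denominator statement «W/V ≍ δ²» together with the argument the paper prints for it, and on the way makes the cancellation EXACT:
which monomials of `V·z_e` survive in `V·z_e − S` and with which coefficient. Serves `tropical/view/V3-VOLKOV-DEGREES.md` §A A.14.2 /
A.38.5 («STILL PRINT-ONLY for 2015–19: §5.2's … W/V orders in the 2016 combinatorial form») and — as a by-product — the cell's
`tropical/theory/T1-EXPONENTS.md` §2 L1 (a) («every coefficient of 𝒲 := U·Σ_{l∈P} z_l − U_• is a non-negative integer: the coefficient of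
z^{E∖F₂} (F₂ any 2-forest) is c(F₂) − [F₂ separates in/out] … the monomials z_e²·z^{E∖T∖e} … are never cancelled», there DERIVED and
machine-checked on 19 words; here a theorem for every edge list: `coeff_kirchhoff_mul_lineSum_sub_twoTree`, `rayOrder_sub_le_of_chord`).

SOURCE [Volkov2016]: С. А. Волков, «Вычитательная процедура для вычисления аномального магнитного момента электрона в КЭД и её
применение для численного расчёта на трёхпетлевом уровне», ЖЭТФ 149 (6) 1164–1191 (2016) = S. A. Volkov, J. Exp. Theor. Phys. 122 (6)
1008–1031 (2016), doi 10.1134/S1063776116050113; Russian original held by the cell (HOME `data/lit/sources/.cache/zhetf149_1164_Volkov2016/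
r_149_1164.pdf`, page texts `…/journal-pdf-pages/ZhETF149-1164-Volkov2016/pNNNN.txt`, PDF page N = journal page 1163 + N; locators «journal
page = pNN:Lnn»). VERBATIM. §5.2, p.1175 = p12:L81–L94 (the IR vector and the first orders): «Инфракрасной расходимости соответствуют
значения β_j = 2 для линий из G′, β_j = 1 для линий из P₁ и P₂, β_j = 0 для остальных линий … V ≍ δ^{N_{G′}−1} (доминирующее по степени δ
дерево состоит из P₁, P₂ и любого 1-дерева G′)»; p.1176 = p13:L25–L29 (the table, last line): «Q̂_l/V ∼ p̂₁, l ∈ P₁, Q̂_l/V ∼ p̂₂, l ∈ P₂,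
W/V ≍ δ² (см. также [48]).»; p13:L30–L113 and p.1177 = p14:L1–L12 (the argument): «Последнее соотношение рассмотрим подробнее. Выражение
V z_e можно представить как Σ_{(T;l)} z_T z_l, где суммирование ведется по всем парам, T — 1-дерево, l — электронная линия в G, z_T —
произведение z_j на хордах T. Ясно, что для любого 2-дерева, для которого электронные внешние линии G инцидентны вершинам в разных
компонентах связности, можно найти линию из электронного пути, соединяющего электронные внешние линии G, которое будет соединять
компоненты связности данного 2-дерева. Поставим в соответствие этому 2-дереву пару (T; l), где l — данная линия, T — дерево, получающееся
добавлением l к 2-дереву. z_T z_l будет равно произведению z_j по хордам 2-дерева, разным 2-деревьям будут сопоставлены разные (T; l).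
Таким образом, расписав выражение для S − V z_e, можно сократить все слагаемые из S и часть слагаемых из V z_e; доминирующее по степени
δ слагаемое из оставшихся и будет определять асимптотическое поведение S − V z_e. Ясно, что все вклады пар (T; l) для доминирующих по
степени δ деревьев T в выражении для V сократятся, поэтому z_T для оставшихся пар будут по порядку не больше δV, при этом z_l тоже по
порядку не больше δ (потому что l — электронная линия), из чего следует, что S − V z_e по порядку не превосходит δ²V. Остается привести
пример пары (T; l), для которой значение не меньше δ²V, это можно сделать для любого G. Отметим также, что данное рассуждение
доказывает, что все коэффициенты полинома S − V z_e отрицательны …» ⟦Consider the last relation in detail. V z_e = Σ over pairs (T; l),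
T a 1-tree, l an electron line of G, of z_T z_l, z_T the chord product of T. For every 2-tree separating the external-electron vertices
one finds a line of the electron path joining its two components; assign to the 2-tree the pair (T; l), l this line, T = the 2-tree
plus l; z_T z_l is the chord product of the 2-tree and different 2-trees get different pairs. So in S − V z_e all terms of S cancel
against part of the terms of V z_e; the δ-dominant one among the remaining terms determines the asymptotics of S − V z_e. Clearly all
contributions of the pairs (T; l) with a δ-dominant tree T cancel, so for the remaining pairs z_T is of order at most δ·V, while z_l is
of order at most δ too (because l is an electron line), whence S − V z_e is of order at most δ²V. It remains to exhibit a pair (T; l)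
whose value is not less than δ²V; this can be done for any G. Note also that this argument proves that all coefficients of S − V z_e
are negative …⟧; footnote 16 (p12:L96–L98): «f(δ) ≍ g(δ) означает, что 0 < C₁ < |f(δ)/g(δ)| < C₂ в некоторой окрестности предельного
значения δ» ⟦f ≍ g means 0 < C₁ < |f/g| < C₂ near the limit value of δ⟧; §5.1 (19): «z₁ ≍ δ^{β₁}, …, z_n ≍ δ^{β_n} при δ → 0».

MODEL (the tree's; nothing new is defined in this file). Edge lists `E : Fin N → Fin (V+1) × Fin (V+1)` (`GraphPeriod.lean`); `edgeRank`,
`loopNumber = ℓ`, `IsSpanningTree` (= «1-дерево»), `edgeGraph E γ` + Mathlib's `SimpleGraph.Reachable` (`IncidenceMatrixRank.lean`); the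
companion's `IsTwoTree` (= «2-дерево»; = `Borinsky2020.SecondSymanzikPermutahedron.IsSpanningTwoForest`, `isTwoTree_iff_isSpanningTwoForest`),
`IsSepTwoTree`, `twoTreePolynomial` = `S`, `lineSum Pe` = `z_e`, `wPolynomial` = `W = S − V·z_e`, `kirchhoffPolynomial` = `V`; Volkov's ray
order `rayOrder` (= `min_{supp} ⟨exponent, β⟩`, §5.1 (19)–(20)) and initial form `initForm` of `RayConvergenceCriterion.lean`; the
two-level vector `β = 𝟙_A + 𝟙_B` (`setIndicator`, `Borinsky2020/LovaszExtension.lean`) with `B ⊆ A`: `β = 2` on `B` («линии из G′»), `1`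
on `A ∖ B` («линии из P₁ и P₂»), `0` elsewhere. THE PRINTED QED SETTING IS ABSTRACTED INTO FIVE HYPOTHESES on `(E, u, w, A, B, Pe)`, each the
edge-list form of a sentence of §5.2 (flagged; evident for a QED magnetic-moment graph without lepton loops with a vertexlike subgraph
`G′ ∋` the external-photon vertex, not modelled here): (H1) `edgeRank E A = V` — the lines of `G′ ∪ P₁ ∪ P₂` reach every vertex of `G`
(every vertex lies on the electron path or in `G′`); (H2) `ℓ(A) = ℓ(B)` — «P₁, P₂ и любое 1-дерево G′» form a 1-tree (as in
`OneTreePolynomialRayOrder.rayOrder_kirchhoffPolynomial_irVector`); (H3) `Pe ⊆ A` — every electron line has `β ≥ 1` («z_l тоже по порядку не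
больше δ (потому что l — электронная линия)»); (H4) `(edgeGraph E Pe).Reachable u w` — the electron path joins the external-electron
vertices (the companion's one hypothesis); (H5) for every electron line `l ∉ G′`, `u` and `w` are disconnected in `A ∖ {l}` — the lines
of `P₁ ∪ P₂` are bridges of the electron path through `G′` (the content of «все вклады пар (T; l) для доминирующих … деревьев T …
сократятся»: for a dominant `T ⊇ P₁ ∪ P₂` and `l ∈ P₁ ∪ P₂`, `T ∖ l` is a SEPARATING 2-tree crossed by `l` alone).

WHAT THE KERNEL CERTIFIES (all PROVED; no definition, no named fact):
* the monomial structure, for EVERY edge list, marked vertices and line set (no hypothesis): `kirchhoff_mul_lineSum_eq_sum_monomial`,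
  `coeff_kirchhoff_mul_lineSum` («V z_e = Σ_{(T;l)} z_T z_l»: the coefficient of `X^d` in `V·z_P` is the NUMBER of pairs with `χ_T + 𝟙_l =
  d`); `coeff_twoTreePolynomial` (the coefficients of `S` are `0/1`, one monomial per separating 2-tree); `IsTwoTree.isSpanningTree_insert_iff`
  («T — дерево, получающееся добавлением l к 2-дереву» ⟺ `l` joins the two components); **`coeff_kirchhoff_mul_lineSum_twoTree`** and
  **`coeff_kirchhoff_mul_lineSum_sub_twoTree`**: for every 2-tree `F`, `coeff_{χ_F}(V·z_P) = #{l ∈ P joining the two components of F}` and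
  `coeff_{χ_F}(V·z_P − S) = #{…} − [F separates u from w]` — the exact content of «можно сократить все слагаемые из S и часть слагаемых из
  V z_e»; `coeff_twoTreePolynomial_eq_zero_of_two_le`, `card_filter_pairs_pos` (the squared monomials `z_T z_l`, `l` a chord of `T`, are
  never cancelled).
* the dominant trees: `loopNumber_le_card_sdiff` (every 1-tree has `≥ ℓ(A)` chords in `A`), **`dominant_tree`** (under (H1), (H2) a
  1-tree of minimal weight `ℓ(A) + ℓ(B)` lies in `A`, contains `A ∖ B` and meets `B` in a maximal forest — «доминирующее по степени δ
  дерево состоит из P₁, P₂ и любого 1-дерева G′» with its converse), `exists_dominant_tree` / `exists_isSpanningTree_nested` (Kruskal),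
  `rayOrder_kirchhoffPolynomial_twoLevel_eq` (`ord_β(V) = ℓ(A) + ℓ(B)`, the companion's value, here by the elementary route).
* **`coeff_pair_eq_zero_of_dominant`** («все вклады пар (T; l) для доминирующих по степени δ деревьев T … сократятся», exact form) and
  **`le_linPair_of_mem_support_sub`** / **`rayOrder_kirchhoffPolynomial_add_two_le_rayOrder_wPolynomial`**: under (H1)–(H5) EVERY monomial
  of `V·z_e − S` has weight `≥ ℓ(A) + ℓ(B) + 2` along `β`, i.e. `ord_β(W) ≥ ord_β(V) + 2` — «S − V z_e по порядку не превосходит δ²V».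
* **`rayOrder_wPolynomial_eq_of_witness`** + `exists_witness_of_edgeRank_erase_eq` / `exists_witness_of_outer_line` («Остается привести
  пример пары (T; l) … это можно сделать для любого G»: two witness pairs — an electron line of `G′` on a cycle of `G′`, or a photon
  outside `G′` over an electron line of `P₁ ∪ P₂`; either exists in every IR configuration of a QED graph) ⟹
  **`rayOrder_wPolynomial_eq_of_inner_cycle`**, **`rayOrder_wPolynomial_eq_of_outer_line`**: `ord_β(W) = ord_β(V) + 2`.
* **`tendsto_wPolynomial_div_kirchhoffPolynomial`** + `div_eval_initForm_neg`, `eval_initForm_wPolynomial_neg`: «W/V ≍ δ²» in footnote 16's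
  sense — along `z_i = c_i δ^{β_i}` (`c_i > 0`), `δ^{−2}·W(z(δ))/V(z(δ)) → W_β(c)/V_β(c) < 0` as `δ → 0⁺` whenever `ord_β(W) = ord_β(V) + 2`.
NOT CLAIMED: that a given QED graph satisfies (H1)–(H5) and has one of the two witnesses (evident per graph from the electron-path
structure; no QED graph model in the edge-list vocabulary is used, as in the companions); the numerator lines of the §5.2 table
(«B_{j₁j₂}/V ≍ 1/δ²», «Q̂_l/V ∼ p̂»: the trees-with-cycle polynomial `B` and the momentum polynomial `Q̂_l` are untyped) and the closing
sentence («порядок роста … в точности равный δ^{−β₁−…−β_n}, если все спаривания внутри G′»), which assembles them; the closed form of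
`ord_y(W) − ord_y(V)` on rays other than two-level IR vectors (the cell's T1 L1 (b) `min_i max(y′_i, 2y′_i − y_i)`, DERIVED there from
NPB 961 Lemma 3.4 with footnote 23 — typed pointwise, in the circuit model, by V3b's `Volkov2020/OnShellDenominatorCircuit.lemma34_two_sided`;
the identification `S/V =` effective resistance (Kirchhoff) that would join the two models is not in the tree); anything per graph of the
cell. presearch (g30): the 2-forest expansion of `V·z_P` / the order of `V z_e − S` on the IR vector → none in the held corpus or galaxy
beyond the source (`lit search --hybrid "on-shell Feynman denominator second Symanzik polynomial cancellation order Hepp sector infrared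
power counting anomalous magnetic moment"` → generic power-counting textbook pages (Grozin, Kleinert–Schulte-Frohlinde, Henn–Plefka);
`lit galaxy search "on-shell denominator|mass-shell singularit|threshold singularit Symanzik" --star all` → noise; 2026-08-25) — cited to
ЖЭТФ §5.2 only; Kruskal's tree and the rank lemmas are the tree's (`KirchhoffPermutahedron`, `SecondSymanzikPermutahedron`).
-/

namespace Literature.MathematicalPhysics.QuantumFieldTheory.Volkov2016

open MvPolynomial
open Literature.MathematicalPhysics.QuantumFieldTheory
open Literature.MathematicalPhysics.QuantumFieldTheory.Borinsky2020

variable {N V : ℕ} {E : Fin N → Fin (V + 1) × Fin (V + 1)}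

/-! ## Plumbing: the chord exponent vector `χ_F = Σ_{e ∉ F} 𝟙_e` -/

section Chords

/-- `χ_S(e) = [e ∈ S]`. [folklore] -/
private theorem finsuppSum_single_one_apply (S : Finset (Fin N)) (e : Fin N) :
    (∑ e' ∈ S, Finsupp.single e' (1 : ℕ)) e = if e ∈ S then 1 else 0 := by
  rw [Finsupp.coe_finsetSum, Finset.sum_apply]
  simp [Finsupp.single_apply, eq_comm]

/-- `S ↦ Σ_{e∈S} 𝟙_e` is injective. [folklore] -/
private theorem finsuppSum_single_one_inj {S T : Finset (Fin N)}
    (h : ∑ e' ∈ S, Finsupp.single e' (1 : ℕ) = ∑ e' ∈ T, Finsupp.single e' (1 : ℕ)) : S = T := by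
  ext e
  have h' := congrArg (fun f : Fin N →₀ ℕ => f e) h
  simp only [finsuppSum_single_one_apply] at h'
  by_cases hS : e ∈ S <;> by_cases hT : e ∈ T <;> simp_all

/-- `χ_T + 𝟙_l = χ_F` iff `l ∉ F` and `T = F ∪ {l}` (compare the two sides at `l` and at `e ≠ l`). [folklore] -/
private theorem compl_add_single_eq_compl_iff (T F : Finset (Fin N)) (l : Fin N) :
    (∑ e' ∈ Tᶜ, Finsupp.single e' (1 : ℕ)) + Finsupp.single l 1 = ∑ e' ∈ Fᶜ, Finsupp.single e' (1 : ℕ) ↔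
      l ∉ F ∧ T = insert l F := by
  constructor
  · intro h
    have hpt : ∀ e, (if e ∈ Tᶜ then 1 else 0) + (if e = l then 1 else 0) = (if e ∈ Fᶜ then (1 : ℕ) else 0) := by
      intro e
      have h' := congrArg (fun f : Fin N →₀ ℕ => f e) h
      simp only [Finsupp.coe_add, Pi.add_apply, finsuppSum_single_one_apply, Finsupp.single_apply,
        @eq_comm _ l e] at h'
      exact h'
    have hl := hpt l
    simp only [Finset.mem_compl, if_true] at hl
    have hlF : l ∉ F := by
      by_contra hlF
      simp [hlF] at hl
    have hlT : l ∈ T := by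
      by_contra hlT
      simp [hlT, hlF] at hl
    refine ⟨hlF, ?_⟩
    ext e
    by_cases hel : e = l
    · subst hel
      simp [hlT]
    · have he := hpt e
      simp only [Finset.mem_compl, hel, if_false, add_zero] at he
      rw [Finset.mem_insert]
      by_cases heT : e ∈ T <;> by_cases heF : e ∈ F <;> simp_all
  · rintro ⟨hlF, rfl⟩
    ext e
    simp only [Finsupp.coe_add, Pi.add_apply, finsuppSum_single_one_apply, Finsupp.single_apply,
      Finset.mem_compl, Finset.mem_insert]
    by_cases hel : e = l
    · subst hel
      simp [hlF]
    · by_cases heF : e ∈ F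
      · simp [hel, heF, Ne.symm hel]
      · simp [hel, heF, Ne.symm hel]

/-- A square-free product of variables times one more variable is a monomial with coefficient `1`. [folklore] -/
private theorem prod_X_mul_X_eq_monomial' (R : Type*) [CommSemiring R] (S : Finset (Fin N)) (l : Fin N) :
    (∏ e ∈ S, (X e : MvPolynomial (Fin N) R)) * X l =
      monomial (∑ e' ∈ S, Finsupp.single e' 1 + Finsupp.single l 1) 1 := by
  classical
  have hprod : ∀ T : Finset (Fin N), ∏ e ∈ T, (X e : MvPolynomial (Fin N) R) =
      monomial (∑ e' ∈ T, Finsupp.single e' 1) 1 := by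
    intro T
    induction T using Finset.induction_on with
    | empty => simp
    | insert a s ha ih =>
      rw [Finset.prod_insert ha, Finset.sum_insert ha, ih, ← pow_one (X a), X_pow_eq_monomial,
        monomial_mul, one_mul]
  rw [hprod, ← pow_one (X l), X_pow_eq_monomial, monomial_mul, one_mul]

/-- A square-free product of variables is the monomial of its exponent vector. [folklore] -/
private theorem prod_X_eq_monomial' (R : Type*) [CommSemiring R] (S : Finset (Fin N)) :
    ∏ e ∈ S, (X e : MvPolynomial (Fin N) R) = monomial (∑ e' ∈ S, Finsupp.single e' 1) 1 := by
  classical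
  induction S using Finset.induction_on with
  | empty => simp
  | insert a s ha ih =>
    rw [Finset.prod_insert ha, Finset.sum_insert ha, ih, ← pow_one (X a), X_pow_eq_monomial,
      monomial_mul, one_mul]

end Chords

/-! ## 2-trees: the two typings agree; a line closes a 2-tree into a 1-tree iff it joins the two components -/

section TwoTrees

/-- The two typings of «2-дерево» / "spanning 2-forest" in the tree agree: this file's companion `IsTwoTree` (ЖЭТФ §5.1,
`|F| + 1 = V = rk F + 1`) and `Borinsky2020.SecondSymanzikPermutahedron`'s `IsSpanningTwoForest` (Brown Def. 1.2, `|F| + 1 = V ∧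
rk F = |F|`). [cite: Volkov2016, §5.1 p.1174 (definition of 2-trees); Brown2017, Def. 1.2] -/
theorem isTwoTree_iff_isSpanningTwoForest (F : Finset (Fin N)) : IsTwoTree E F ↔ IsSpanningTwoForest E F := by
  unfold IsTwoTree IsSpanningTwoForest
  omega

/-- **«T — дерево, получающееся добавлением l к 2-дереву»** in both directions: for a 2-tree `F`, `F ∪ {l}` is a spanning 1-tree
iff `l` is not a line of `F` and its two endpoints lie in different components of `⟨F⟩` (rank form: the row `𝟙_a − 𝟙_b` of `l`
lies outside the row span of `F` iff `a ≁_F b`, Biggs Prop. 4.3). [cite: Volkov2016, §5.2 p.1176 (PDF p.13 L102–L105); Biggs1974, Ch. 4 Prop. 4.3] -/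
theorem IsTwoTree.isSpanningTree_insert_iff {F : Finset (Fin N)} (hF : IsTwoTree E F) (l : Fin N) :
    IsSpanningTree E (insert l F) ↔ l ∉ F ∧ ¬ (edgeGraph E F).Reachable (E l).1 (E l).2 := by
  classical
  have hcardF : F.card + 1 = V := hF.1
  have hrkF : edgeRank E F + 1 = V := hF.2
  constructor
  · intro hT
    have hlF : l ∉ F := by
      intro hlF
      have := hT.1
      rw [Finset.insert_eq_of_mem hlF] at this
      omega
    refine ⟨hlF, fun hreach => ?_⟩
    have hmem := (reachable_iff_single_sub_single_mem_span E F _ _).1 hreach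
    have hle : Submodule.span ℚ (Set.range (incidenceRows ℚ E (insert l F))) ≤
        Submodule.span ℚ (Set.range (incidenceRows ℚ E F)) := by
      refine Submodule.span_le.2 ?_
      rintro _ ⟨⟨e, he⟩, rfl⟩
      rcases Finset.mem_insert.1 he with hel | heF
      · rw [incidenceRows_row_eq_single_sub_single]
        simp only [hel]
        exact hmem
      · have hrow : incidenceRows ℚ E (insert l F) ⟨e, he⟩ = incidenceRows ℚ E F ⟨e, heF⟩ := by
          rw [incidenceRows_row_eq_single_sub_single, incidenceRows_row_eq_single_sub_single]
        rw [hrow]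
        exact Submodule.subset_span ⟨⟨e, heF⟩, rfl⟩
    have hrk := Submodule.finrank_mono hle
    rw [← edgeRank_eq_finrank_span_incidenceRows, ← edgeRank_eq_finrank_span_incidenceRows, hT.2] at hrk
    omega
  · rintro ⟨hlF, hnr⟩
    refine ⟨by rw [Finset.card_insert_of_notMem hlF, hcardF], le_antisymm (edgeRank_le E _) ?_⟩
    have hnot : (Pi.single (E l).1 (1 : ℚ) - Pi.single (E l).2 1) ∉
        Submodule.span ℚ (Set.range (incidenceRows ℚ E F)) :=
      fun h => hnr ((reachable_iff_single_sub_single_mem_span E F _ _).2 h)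
    have hin : (Pi.single (E l).1 (1 : ℚ) - Pi.single (E l).2 1) ∈
        Submodule.span ℚ (Set.range (incidenceRows ℚ E (insert l F))) := by
      rw [← incidenceRows_row_eq_single_sub_single E (insert l F) ⟨l, Finset.mem_insert_self l F⟩]
      exact Submodule.subset_span ⟨⟨l, Finset.mem_insert_self l F⟩, rfl⟩
    have hlt : Submodule.span ℚ (Set.range (incidenceRows ℚ E F)) <
        Submodule.span ℚ (Set.range (incidenceRows ℚ E (insert l F))) :=
      lt_of_le_of_ne (span_incidenceRows_mono E (Finset.subset_insert l F)) fun heq => hnot (heq ▸ hin)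
    have h := Submodule.finrank_lt_finrank_of_lt hlt
    rw [← edgeRank_eq_finrank_span_incidenceRows, ← edgeRank_eq_finrank_span_incidenceRows] at h
    omega

/-- Deleting a line of a spanning 1-tree leaves a 2-tree. [cite: Volkov2016, §5.2 p.1176 (PDF p.13 L102–L105); Brown2017, Lemma 1.12 (proof)] -/
theorem _root_.Literature.MathematicalPhysics.QuantumFieldTheory.IsSpanningTree.isTwoTree_erase {T : Finset (Fin N)}
    (hT : IsSpanningTree E T) {l : Fin N} (hl : l ∈ T) :
    IsTwoTree E (T.erase l) :=
  (isTwoTree_iff_isSpanningTwoForest _).2 (hT.isSpanningTwoForest_erase hl)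

end TwoTrees

/-! ## The monomials of `S` and of `V·z_e`: «Выражение V z_e можно представить как Σ_{(T;l)} z_T z_l» made exact -/

section Coefficients

variable (R : Type*) [CommRing R]

open scoped Classical in
/-- `S` as a sum of monomials: one square-free monomial `X^{χ_F}` per separating 2-tree `F`.
[cite: Volkov2016, §5.1 p.1174 (definition of S)] -/
theorem twoTreePolynomial_eq_sum_monomial (u w : Fin (V + 1)) :
    twoTreePolynomial R E u w =
      ∑ F ∈ Finset.univ.filter (IsSepTwoTree E u w), monomial (∑ e' ∈ Fᶜ, Finsupp.single e' 1) (1 : R) := by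
  rw [twoTreePolynomial]
  exact Finset.sum_congr rfl fun F _ => prod_X_eq_monomial' R _

open scoped Classical in
/-- **The coefficients of `S` are `0` or `1`**: the coefficient of `X^d` is `1` iff `d = χ_F` for a separating 2-tree `F`
(distinct 2-trees have distinct chord sets). [cite: Volkov2016, §5.1 p.1174 (definition of S)] -/
theorem coeff_twoTreePolynomial (u w : Fin (V + 1)) (d : Fin N →₀ ℕ) :
    coeff d (twoTreePolynomial R E u w) =
      if ∃ F, IsSepTwoTree E u w F ∧ ∑ e' ∈ Fᶜ, Finsupp.single e' 1 = d then 1 else 0 := by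
  rw [twoTreePolynomial_eq_sum_monomial, coeff_sum]
  simp only [coeff_monomial]
  by_cases h : ∃ F, IsSepTwoTree E u w F ∧ ∑ e' ∈ Fᶜ, Finsupp.single e' 1 = d
  · obtain ⟨F, hF, hFd⟩ := h
    rw [if_pos ⟨F, hF, hFd⟩, Finset.sum_eq_single_of_mem F ((Finset.mem_filter_univ _).2 hF)
      (fun F' _ hne => if_neg fun h' => hne (compl_injective
        (finsuppSum_single_one_inj (h'.trans hFd.symm)))), if_pos hFd]
  · rw [if_neg h]
    exact Finset.sum_eq_zero fun F hF => if_neg fun h' => h ⟨F, (Finset.mem_filter_univ _).1 hF, h'⟩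

/-- The coefficient of the chord monomial `X^{χ_F}` in `S` is `[F is a separating 2-tree]`.
[cite: Volkov2016, §5.1 p.1174 (definition of S)] -/
theorem coeff_twoTreePolynomial_compl (u w : Fin (V + 1)) (F : Finset (Fin N)) [Decidable (IsSepTwoTree E u w F)] :
    coeff (∑ e' ∈ Fᶜ, Finsupp.single e' 1) (twoTreePolynomial R E u w) =
      if IsSepTwoTree E u w F then 1 else 0 := by
  classical
  rw [coeff_twoTreePolynomial]
  by_cases hF : IsSepTwoTree E u w F
  · rw [if_pos ⟨F, hF, rfl⟩, if_pos hF]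
  · rw [if_neg hF, if_neg]
    rintro ⟨F', hF', h⟩
    exact hF (compl_injective (finsuppSum_single_one_inj h) ▸ hF')

/-- `S` is square-free: a monomial in which some variable occurs with exponent `≥ 2` has coefficient `0` in `S`.
[cite: Volkov2016, §5.1 p.1174 (definition of S: products over chords of 2-trees)] -/
theorem coeff_twoTreePolynomial_eq_zero_of_two_le (u w : Fin (V + 1)) {d : Fin N →₀ ℕ} {l : Fin N} (hl : 2 ≤ d l) :
    coeff d (twoTreePolynomial R E u w) = 0 := by
  classical
  rw [coeff_twoTreePolynomial, if_neg]
  rintro ⟨F, -, hFd⟩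
  have h := congrArg (fun f : Fin N →₀ ℕ => f l) hFd
  simp only [finsuppSum_single_one_apply] at h
  split_ifs at h <;> omega

open scoped Classical in
/-- **«Выражение V z_e можно представить как Σ_{(T;l)} z_T z_l, где суммирование ведется по всем парам, T — 1-дерево, l — электронная
линия»** ⟦V z_e = Σ over all pairs (T; l), T a 1-tree, l an electron line, of z_T z_l⟧: `V·z_P = Σ_{(T,l)} X^{χ_T + 𝟙_l}` over the pairs
(spanning 1-tree, line of `P`). [cite: Volkov2016, §5.2 p.1176 (PDF p.13 L91–L95)] -/
theorem kirchhoff_mul_lineSum_eq_sum_monomial (P : Finset (Fin N)) :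
    kirchhoffPolynomial R E * lineSum R P =
      ∑ p ∈ (Finset.univ.filter (IsSpanningTree E)) ×ˢ P,
        monomial (∑ e' ∈ p.1ᶜ, Finsupp.single e' 1 + Finsupp.single p.2 1) (1 : R) := by
  rw [Finset.sum_product, kirchhoffPolynomial_eq_sum_oneTrees R E, lineSum, Finset.sum_mul_sum]
  refine Finset.sum_congr rfl fun T _ => Finset.sum_congr rfl fun l _ => ?_
  exact prod_X_mul_X_eq_monomial' R _ _

open scoped Classical in
/-- **The coefficients of `V·z_P` count pairs**: the coefficient of `X^d` is the number of pairs (spanning 1-tree `T`, line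
`l ∈ P`) with `χ_T + 𝟙_l = d`. [cite: Volkov2016, §5.2 p.1176 (PDF p.13 L91–L95)] -/
theorem coeff_kirchhoff_mul_lineSum (P : Finset (Fin N)) (d : Fin N →₀ ℕ) :
    coeff d (kirchhoffPolynomial R E * lineSum R P) =
      ((((Finset.univ.filter (IsSpanningTree E)) ×ˢ P).filter fun p =>
        ∑ e' ∈ p.1ᶜ, Finsupp.single e' 1 + Finsupp.single p.2 1 = d).card : R) := by
  rw [kirchhoff_mul_lineSum_eq_sum_monomial, coeff_sum]
  simp only [coeff_monomial]
  rw [Finset.sum_boole]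

open scoped Classical in
/-- Every monomial of `V·z_P` comes from a pair: if `coeff_d (V·z_P) ≠ 0` then `d = χ_T + 𝟙_l` for a spanning 1-tree `T` and a
line `l ∈ P`. [cite: Volkov2016, §5.2 p.1176 (PDF p.13 L91–L95)] -/
theorem exists_pair_of_coeff_kirchhoff_mul_lineSum_ne_zero {P : Finset (Fin N)} {d : Fin N →₀ ℕ}
    (hd : coeff d (kirchhoffPolynomial R E * lineSum R P) ≠ 0) :
    ∃ T l, IsSpanningTree E T ∧ l ∈ P ∧ ∑ e' ∈ Tᶜ, Finsupp.single e' 1 + Finsupp.single l 1 = d := by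
  rw [coeff_kirchhoff_mul_lineSum] at hd
  set s := ((Finset.univ.filter (IsSpanningTree E)) ×ˢ P).filter fun p =>
    ∑ e' ∈ p.1ᶜ, Finsupp.single e' 1 + Finsupp.single p.2 1 = d with hs
  have hne : s.Nonempty := Finset.card_ne_zero.1 fun h => hd (by rw [h, Nat.cast_zero])
  obtain ⟨p, hp⟩ := hne
  rw [hs, Finset.mem_filter, Finset.mem_product, Finset.mem_filter_univ] at hp
  exact ⟨p.1, p.2, hp.1.1, hp.1.2, hp.2⟩

open scoped Classical in
/-- **The 2-tree monomials of `V·z_P`**: for a 2-tree `F` the coefficient of `X^{χ_F}` in `V·z_P` is the number of lines of `P` whose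
endpoints lie in different components of `⟨F⟩` (the pairs `(F ∪ {l}, l)` with `l` crossing — «Поставим в соответствие этому 2-дереву
пару (T; l), где l — данная линия, T — дерево, получающееся добавлением l к 2-дереву», counted over ALL crossing lines of `P`).
[cite: Volkov2016, §5.2 p.1176 (PDF p.13 L96–L106)] -/
theorem coeff_kirchhoff_mul_lineSum_twoTree {F : Finset (Fin N)} (hF : IsTwoTree E F) (P : Finset (Fin N)) :
    coeff (∑ e' ∈ Fᶜ, Finsupp.single e' 1) (kirchhoffPolynomial R E * lineSum R P) =
      ((P.filter fun l => ¬ (edgeGraph E F).Reachable (E l).1 (E l).2).card : R) := by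
  rw [coeff_kirchhoff_mul_lineSum]
  congr 1
  refine Finset.card_bij' (fun p _ => p.2) (fun l _ => (insert l F, l)) ?_ ?_ ?_ ?_
  · intro p hp
    rw [Finset.mem_filter, Finset.mem_product, Finset.mem_filter_univ] at hp
    obtain ⟨⟨hT, hl⟩, hd⟩ := hp
    obtain ⟨hlF, hTeq⟩ := (compl_add_single_eq_compl_iff _ _ _).1 hd
    rw [hTeq] at hT
    exact Finset.mem_filter.2 ⟨hl, ((hF.isSpanningTree_insert_iff _).1 hT).2⟩
  · intro l hl
    rw [Finset.mem_filter] at hl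
    obtain ⟨hlP, hnr⟩ := hl
    have hlF : l ∉ F := fun hlF =>
      hnr (SimpleGraph.ConnectedComponent.exact (connectedComponentMk_fst_eq E hlF))
    rw [Finset.mem_filter, Finset.mem_product, Finset.mem_filter_univ]
    exact ⟨⟨(hF.isSpanningTree_insert_iff l).2 ⟨hlF, hnr⟩, hlP⟩, (compl_add_single_eq_compl_iff _ _ _).2 ⟨hlF, rfl⟩⟩
  · intro p hp
    rw [Finset.mem_filter, Finset.mem_product, Finset.mem_filter_univ] at hp
    obtain ⟨hlF, hTeq⟩ := (compl_add_single_eq_compl_iff _ _ _).1 hp.2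
    ext <;> simp [hTeq]
  · intro l _
    rfl

/-- **The exact coefficients of `V·z_e − S` on the 2-tree monomials** (what «можно сократить все слагаемые из S и часть слагаемых из
V z_e» ⟦all terms of S cancel against part of the terms of V z_e⟧ leaves behind): for every 2-tree `F`,
`coeff_{χ_F}(V·z_P − S) = #{l ∈ P : l joins the two components of F} − [F separates u from w]`.
[cite: Volkov2016, §5.2 p.1176 (PDF p.13 L96–L108)] -/
theorem coeff_kirchhoff_mul_lineSum_sub_twoTree (u w : Fin (V + 1)) {F : Finset (Fin N)} (hF : IsTwoTree E F)
    [Decidable (IsSepTwoTree E u w F)] (P : Finset (Fin N)) :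
    coeff (∑ e' ∈ Fᶜ, Finsupp.single e' 1) (kirchhoffPolynomial R E * lineSum R P - twoTreePolynomial R E u w) =
      ((P.filter fun l => ¬ (edgeGraph E F).Reachable (E l).1 (E l).2).card : R) -
        if IsSepTwoTree E u w F then 1 else 0 := by
  rw [coeff_sub, coeff_kirchhoff_mul_lineSum_twoTree R hF, coeff_twoTreePolynomial_compl]

/-- A separating 2-tree is crossed by at least one line of any `P` joining `u` to `w` (so the coefficient above is `≥ 0`; the
companion's `coeff_kirchhoff_mul_lineSum_sub_nonneg`). [cite: Volkov2016, §5.2 p.1176 (PDF p.13 L96–L102)] -/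
theorem one_le_card_filter_crossing_of_isSepTwoTree {u w : Fin (V + 1)} {F : Finset (Fin N)} (hF : IsSepTwoTree E u w F)
    {P : Finset (Fin N)} (hP : (edgeGraph E P).Reachable u w) :
    1 ≤ (P.filter fun l => ¬ (edgeGraph E F).Reachable (E l).1 (E l).2).card := by
  obtain ⟨l, hlP, hl⟩ := hF.exists_crossing hP
  exact Finset.card_pos.2 ⟨l, Finset.mem_filter.2 ⟨hlP, fun h => hl (SimpleGraph.ConnectedComponent.sound h)⟩⟩

open scoped Classical in
/-- **The squared monomials of `V·z_e`** («z_l тоже …»: the pairs `(T; l)` with `l` a CHORD of `T` give `z_T z_l` with `z_l²`): for a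
spanning 1-tree `T` and `l ∈ P`, `l ∉ T`, the monomial `X^{χ_T + 𝟙_l}` occurs in `V·z_P` (at least the pair `(T, l)` produces it)
and not in `S`. [cite: Volkov2016, §5.2 p.1176 (PDF p.13 L91–L95)] -/
theorem card_filter_pairs_pos {T : Finset (Fin N)} (hT : IsSpanningTree E T) {P : Finset (Fin N)} {l : Fin N} (hl : l ∈ P) :
    0 < (((Finset.univ.filter (IsSpanningTree E)) ×ˢ P).filter fun p =>
        ∑ e' ∈ p.1ᶜ, Finsupp.single e' 1 + Finsupp.single p.2 1 =
          ∑ e' ∈ Tᶜ, Finsupp.single e' (1 : ℕ) + Finsupp.single l 1).card :=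
  Finset.card_pos.2 ⟨(T, l), Finset.mem_filter.2
    ⟨Finset.mem_product.2 ⟨(Finset.mem_filter_univ _).2 hT, hl⟩, rfl⟩⟩

/-- The exponent of `l` in `χ_T + 𝟙_l` is `2` when `l ∉ T`. [folklore] -/
private theorem compl_add_single_apply_of_not_mem {T : Finset (Fin N)} {l : Fin N} (hl : l ∉ T) :
    ((∑ e' ∈ Tᶜ, Finsupp.single e' (1 : ℕ)) + Finsupp.single l 1 : Fin N →₀ ℕ) l = 2 := by
  simp only [Finsupp.coe_add, Pi.add_apply, finsuppSum_single_one_apply, Finset.mem_compl, hl,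
    not_false_eq_true, if_true, Finsupp.single_eq_same]

end Coefficients

/-! ## Weights along a two-level vector `β = 𝟙_A + 𝟙_B` (`B ⊆ A`: `β = 2` on `B`, `1` on `A ∖ B`, `0` elsewhere) -/

section Weights

/-- `Σ_{i∈I} 1_A(i) = |I ∩ A|`. [folklore] -/
private theorem sum_setIndicator' (A I : Finset (Fin N)) : ∑ i ∈ I, setIndicator A i = ((I ∩ A).card : ℝ) := by
  simp only [setIndicator]
  rw [Finset.sum_boole, Finset.filter_mem_eq_inter]

/-- `Tᶜ ∩ A = A ∖ T`. [folklore] -/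
private theorem compl_inter_eq_sdiff (T A : Finset (Fin N)) : Tᶜ ∩ A = A \ T := by
  ext e
  simp [and_comm]

/-- The weight is additive in the exponent: `⟨d₁ + d₂, β⟩ = ⟨d₁, β⟩ + ⟨d₂, β⟩`. [folklore] -/
private theorem linPair_castExp_add (d₁ d₂ : Fin N →₀ ℕ) (β : Fin N → ℝ) :
    linPair (castExp (d₁ + d₂)) β = linPair (castExp d₁) β + linPair (castExp d₂) β := by
  simp only [linPair, castExp, Finsupp.coe_add, Pi.add_apply, Nat.cast_add, add_mul, Finset.sum_add_distrib]

/-- `⟨𝟙_l, β⟩ = β_l`. [folklore] -/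
private theorem linPair_castExp_single (l : Fin N) (β : Fin N → ℝ) : linPair (castExp (Finsupp.single l 1)) β = β l := by
  classical
  simp only [linPair, castExp, Finsupp.single_apply]
  rw [Finset.sum_eq_single l (fun b _ hb => by simp [Ne.symm hb]) (fun h => absurd (Finset.mem_univ l) h)]
  simp

/-- **The weight of a chord monomial along `𝟙_A + 𝟙_B`**: `⟨χ_T, 𝟙_A + 𝟙_B⟩ = |A ∖ T| + |B ∖ T|` (the number of chords of `T` in
`A`, plus the number in `B` — «по степени δ» of `z_T` along `β`). [cite: Volkov2016, §5.2 p.1175–1176 (PDF p.12 L92–L94, p.13 L106–L113)] -/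
theorem linPair_castExp_compl_twoLevel (T A B : Finset (Fin N)) :
    linPair (castExp (∑ e' ∈ Tᶜ, Finsupp.single e' (1 : ℕ))) (fun e => setIndicator A e + setIndicator B e) =
      ((A \ T).card : ℝ) + (B \ T).card := by
  classical
  simp only [linPair, castExp, finsuppSum_single_one_apply]
  rw [show (∑ i, ((if i ∈ Tᶜ then (1 : ℕ) else 0 : ℕ) : ℝ) * (setIndicator A i + setIndicator B i)) =
      ∑ i ∈ Tᶜ, (setIndicator A i + setIndicator B i) by
    rw [← Finset.sum_filter_add_sum_filter_not Finset.univ (fun i => i ∈ Tᶜ)]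
    rw [Finset.sum_eq_zero (s := Finset.univ.filter fun i => ¬ i ∈ Tᶜ)
      (fun i hi => by rw [Finset.mem_filter] at hi; simp [hi.2]), add_zero, Finset.filter_mem_eq_inter,
      Finset.univ_inter]
    exact Finset.sum_congr rfl fun i hi => by simp [hi],
    Finset.sum_add_distrib, sum_setIndicator', sum_setIndicator', compl_inter_eq_sdiff, compl_inter_eq_sdiff]

/-- **The weight of a pair monomial**: `⟨χ_T + 𝟙_l, 𝟙_A + 𝟙_B⟩ = |A ∖ T| + |B ∖ T| + 1_A(l) + 1_B(l)` («z_T … при этом z_l тоже …»).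
[cite: Volkov2016, §5.2 p.1176–1177 (PDF p.13 L111–L113, p.14 L1–L3)] -/
theorem linPair_castExp_pair_twoLevel (T A B : Finset (Fin N)) (l : Fin N) :
    linPair (castExp (∑ e' ∈ Tᶜ, Finsupp.single e' (1 : ℕ) + Finsupp.single l 1))
        (fun e => setIndicator A e + setIndicator B e) =
      ((A \ T).card : ℝ) + (B \ T).card + (setIndicator A l + setIndicator B l) := by
  rw [linPair_castExp_add, linPair_castExp_compl_twoLevel, linPair_castExp_single]

/-- **Every 1-tree has at least `ℓ(A)` chords in `A`** (`|A ∩ T| ≤ rk A` for the forest `A ∩ T`): the lower bound behind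
«доминирующее по степени δ дерево». [cite: Volkov2016, §5.2 p.1175 (PDF p.12 L92–L94); Oxley2011, §1.3 (rank axioms)] -/
theorem card_inter_le_edgeRank {T : Finset (Fin N)} (hT : IsSpanningTree E T) (A : Finset (Fin N)) :
    (A ∩ T).card ≤ edgeRank E A := by
  have hind : edgeRank E (A ∩ T) = (A ∩ T).card :=
    edgeRank_eq_card_of_subset (hT.2.trans hT.1.symm) Finset.inter_subset_right
  rw [← hind]
  exact edgeRank_mono Finset.inter_subset_left

/-- Hence `ℓ(A) ≤ |A ∖ T|` for every spanning 1-tree `T` and every line set `A`.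
[cite: Volkov2016, §5.2 p.1175 (PDF p.12 L92–L94)] -/
theorem loopNumber_le_card_sdiff {T : Finset (Fin N)} (hT : IsSpanningTree E T) (A : Finset (Fin N)) :
    loopNumber E A ≤ (A \ T).card := by
  have h1 := card_inter_le_edgeRank hT A
  have h2 := Finset.card_sdiff_add_card_inter A T
  unfold loopNumber
  omega

/-- **The δ-dominant 1-trees along `𝟙_A + 𝟙_B`** («доминирующее по степени δ дерево состоит из P₁, P₂ и любого 1-дерева G′» ⟦the
δ-dominant tree consists of P₁, P₂ and any 1-tree of G′⟧, in general form): if the lines of `A` reach every vertex (`rk A = V`),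
`B ⊆ A` and `ℓ(A) = ℓ(B)`, then a spanning 1-tree of minimal weight `ℓ(A) + ℓ(B)` lies inside `A`, contains every line of `A ∖ B`,
and meets `B` in a maximal forest of `B` (`|B ∩ T| = rk B`). [cite: Volkov2016, §5.2 p.1175 (PDF p.12 L92–L94) and p.1176 (PDF p.13 L110–L113)] -/
theorem dominant_tree {T A B : Finset (Fin N)} (hT : IsSpanningTree E T) (hA : edgeRank E A = V) (hBA : B ⊆ A)
    (hAB : loopNumber E A = loopNumber E B) (hdom : (A \ T).card + (B \ T).card = loopNumber E A + loopNumber E B) :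
    T ⊆ A ∧ A \ B ⊆ T ∧ (B ∩ T).card = edgeRank E B := by
  have hA1 := loopNumber_le_card_sdiff hT A
  have hB1 := loopNumber_le_card_sdiff hT B
  have hAeq : (A \ T).card = loopNumber E A := by omega
  have hBeq : (B \ T).card = loopNumber E B := by omega
  have hA2 := card_inter_le_edgeRank hT A
  have hB2 := card_inter_le_edgeRank hT B
  have hA3 := Finset.card_sdiff_add_card_inter A T
  have hB3 := Finset.card_sdiff_add_card_inter B T
  have hrkA := edgeRank_le_card E A
  have hrkB := edgeRank_le_card E B
  have hATcard : (A ∩ T).card = T.card := by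
    rw [hT.1]; unfold loopNumber at hAeq; omega
  have hTA : T ⊆ A := by
    have := Finset.eq_of_subset_of_card_le Finset.inter_subset_right hATcard.ge
    exact this ▸ Finset.inter_subset_left
  have hBT : (B ∩ T).card = edgeRank E B := by unfold loopNumber at hBeq; omega
  refine ⟨hTA, ?_, hBT⟩
  have hsub : B \ T ⊆ A \ T := Finset.sdiff_subset_sdiff hBA le_rfl
  have hcard : ((A \ T) \ (B \ T)).card = 0 := by
    rw [Finset.card_sdiff_of_subset hsub, hAeq, hBeq, hAB, Nat.sub_self]
  have hempty := Finset.card_eq_zero.1 hcard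
  intro e he
  rw [Finset.mem_sdiff] at he
  by_contra heT
  have : e ∈ (A \ T) \ (B \ T) := by
    simp only [Finset.mem_sdiff]
    exact ⟨⟨he.1, heT⟩, fun h => he.2 h.1⟩
  rw [hempty] at this
  exact Finset.notMem_empty e this

/-- **Kruskal's tree for a nested triple**: a connected edge list has a spanning 1-tree meeting each of `S₁ ⊆ S₂ ⊆ S₃` in a maximal
forest (`|T ∩ S_i| = rk S_i`) — the greedy tree of an order listing `S₁` first, then `S₂`, then `S₃` (Panzer Lemma 2.8 / Borinsky
Remark 33, as typed in `KirchhoffPermutahedron.exists_isSpanningTree_card_inter_chainSet`). [cite: Panzer2022, §2.2 Lemma 2.8; Borinsky2020, Remark 33] -/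
theorem exists_isSpanningTree_nested (hconn : IsConnectedEdgeList E) {S₁ S₂ S₃ : Finset (Fin N)} (h₁₂ : S₁ ⊆ S₂)
    (h₂₃ : S₂ ⊆ S₃) :
    ∃ T : Finset (Fin N), IsSpanningTree E T ∧ (T ∩ S₁).card = edgeRank E S₁ ∧ (T ∩ S₂).card = edgeRank E S₂ ∧
      (T ∩ S₃).card = edgeRank E S₃ := by
  classical
  set y : Fin N → ℝ := fun e => -(setIndicator S₁ e + setIndicator S₂ e + setIndicator S₃ e) with hy
  have hyC : y ∈ weylChamber (Tuple.sort y) := mem_weylChamber_sort y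
  obtain ⟨T, hT, hcount⟩ := exists_isSpanningTree_card_inter_chainSet E hconn (Tuple.sort y)
  have hlow : ∀ S : Finset (Fin N), (∀ i ∈ S, ∀ i' ∉ S, y i < y i') → (T ∩ S).card = edgeRank E S := by
    intro S hS
    have h := chainSet_card_eq_of_lowerSet hyC hS
    rw [← h]
    exact hcount S.card
  have h01 : ∀ (S : Finset (Fin N)) (i : Fin N), 0 ≤ setIndicator S i ∧ setIndicator S i ≤ 1 := fun S i => by
    unfold setIndicator
    split_ifs <;> norm_num
  have hmem : ∀ (S : Finset (Fin N)) (i : Fin N), i ∈ S → setIndicator S i = 1 := fun S i h => if_pos h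
  have hnm : ∀ (S : Finset (Fin N)) (i : Fin N), i ∉ S → setIndicator S i = 0 := fun S i h => if_neg h
  refine ⟨T, hT, hlow S₁ ?_, hlow S₂ ?_, hlow S₃ ?_⟩
  · intro i hi i' hi'
    have e1 := hmem S₁ i hi
    have e2 := hmem S₂ i (h₁₂ hi)
    have e3 := hmem S₃ i (h₂₃ (h₁₂ hi))
    have e4 := hnm S₁ i' hi'
    have b2 := h01 S₂ i'
    have b3 := h01 S₃ i'
    simp only [hy]
    linarith [b2.1, b2.2, b3.1, b3.2]
  · intro i hi i' hi'
    have e2 := hmem S₂ i hi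
    have e3 := hmem S₃ i (h₂₃ hi)
    have e4 := hnm S₁ i' fun h => hi' (h₁₂ h)
    have e5 := hnm S₂ i' hi'
    have b1 := h01 S₁ i
    have b3 := h01 S₃ i'
    simp only [hy]
    linarith [b1.1, b1.2, b3.1, b3.2]
  · intro i hi i' hi'
    have e3 := hmem S₃ i hi
    have e4 := hnm S₁ i' fun h => hi' (h₂₃ (h₁₂ h))
    have e5 := hnm S₂ i' fun h => hi' (h₂₃ h)
    have e6 := hnm S₃ i' hi'
    have b1 := h01 S₁ i
    have b2 := h01 S₂ i
    simp only [hy]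
    linarith [b1.1, b1.2, b2.1, b2.2]

/-- If the lines of a subset `A` already have full rank `V` (reach every vertex) then the edge list is connected (rank is monotone and at
most `V = n − 1`; Biggs: rank `n − c`, so `c = 1`). [cite: Biggs1974, Ch. 4 Prop. 4.3 (rank n − c)] -/
theorem isConnectedEdgeList_of_edgeRank_eq {A : Finset (Fin N)} (hA : edgeRank E A = V) : IsConnectedEdgeList E := by
  rw [isConnectedEdgeList_iff_edgeRank_univ]
  refine le_antisymm (edgeRank_le E _) ?_
  calc V = edgeRank E A := hA.symm
    _ ≤ edgeRank E Finset.univ := edgeRank_mono (Finset.subset_univ A)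

/-- **«V ≍ δ^{…}»: the order of `V` along `𝟙_A + 𝟙_B` is `ℓ(A) + ℓ(B)`** (for `B ⊆ A`, `rk A = V`), here by the elementary route
(every 1-tree has `≥ ℓ` chords in `A` and in `B`; Kruskal's tree for `B ⊆ A` attains both) — the same value as the companion
`OneTreePolynomialRayOrder.rayOrder_kirchhoffPolynomial_twoLevel_of_subset` (which reads it off Borinsky's generalized permutahedron).
[cite: Volkov2016, §5.2 p.1175 (PDF p.12 L92–L94)] -/
theorem rayOrder_kirchhoffPolynomial_twoLevel_eq {A B : Finset (Fin N)} (hA : edgeRank E A = V) (hBA : B ⊆ A) :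
    rayOrder (kirchhoffPolynomial ℝ E) (fun e => setIndicator A e + setIndicator B e) =
      (loopNumber E A : ℝ) + loopNumber E B := by
  classical
  have hconn := isConnectedEdgeList_of_edgeRank_eq hA
  have hne : kirchhoffPolynomial ℝ E ≠ 0 := kirchhoffPolynomial_ne_zero E ℝ hconn
  rw [rayOrder_eq_inf' hne]
  refine le_antisymm ?_ (Finset.le_inf' _ _ fun d hd => ?_)
  · obtain ⟨T, hT, -, hTB, hTA⟩ := exists_isSpanningTree_nested hconn (Finset.empty_subset B) hBA
    refine (Finset.inf'_le _ (sum_single_compl_mem_support E hT)).trans (le_of_eq ?_)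
    rw [linPair_castExp_compl_twoLevel]
    have h1 := Finset.card_sdiff_add_card_inter A T
    have h2 := Finset.card_sdiff_add_card_inter B T
    rw [Finset.inter_comm] at hTA hTB
    have hrA := edgeRank_le_card E A
    have hrB := edgeRank_le_card E B
    have e1 : (A \ T).card = loopNumber E A := by unfold loopNumber; omega
    have e2 : (B \ T).card = loopNumber E B := by unfold loopNumber; omega
    rw [e1, e2]
  · obtain ⟨T, hT, rfl⟩ := exists_isSpanningTree_of_mem_support E hd
    rw [linPair_castExp_compl_twoLevel]
    exact_mod_cast Nat.add_le_add (loopNumber_le_card_sdiff hT A) (loopNumber_le_card_sdiff hT B)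

end Weights

/-! ## «S − V z_e по порядку не превосходит δ²V»: every monomial of `V·z_e − S` has weight `≥ ord(V) + 2` along the IR vector -/

section Order

variable {u w : Fin (V + 1)} {A B Pe : Finset (Fin N)}

/-- In a dominant tree the lines of `B ∩ T` already join the endpoints of every line of `B` (`B ∩ T` is a maximal forest of `B`:
same rank ⇒ same components). Plumbing for the cancellation step. [cite: Biggs1974, Ch. 4 Prop. 4.3; Panzer2022, §2.2 Lemma 2.8] -/
theorem reachable_inter_of_mem {T : Finset (Fin N)} (hT : IsSpanningTree E T) (hBT : (B ∩ T).card = edgeRank E B)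
    {l : Fin N} (hl : l ∈ B) : (edgeGraph E (B ∩ T)).Reachable (E l).1 (E l).2 := by
  have hind : edgeRank E (B ∩ T) = (B ∩ T).card :=
    edgeRank_eq_card_of_subset (hT.2.trans hT.1.symm) Finset.inter_subset_right
  rw [reachable_iff_reachable_of_subset_of_edgeRank_eq E Finset.inter_subset_left (hind.trans hBT)]
  exact SimpleGraph.ConnectedComponent.exact (connectedComponentMk_fst_eq E hl)

/-- **The cancellation of the dominant pairs** («Ясно, что все вклады пар (T;l) для доминирующих по степени δ деревьев T в выражении
для V сократятся» ⟦clearly all contributions of the pairs (T; l) with a δ-dominant tree T cancel⟧), made precise: if `T` is a dominant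
1-tree (`T ⊆ A`, `A ∖ B ⊆ T`, `|B ∩ T| = rk B`) and `l ∈ Pe ∖ B` is a line whose removal from `A` disconnects `u` from `w`, then the
2-tree `T ∖ {l}` separates `u` from `w` and `l` is the ONLY line of `Pe` (`Pe ⊆ A`) joining its two components — so the monomial
`X^{χ_T + 𝟙_l} = X^{χ_{T∖l}}` has coefficient `1 − 1 = 0` in `V·z_e − S`. [cite: Volkov2016, §5.2 p.1176–1177 (PDF p.13 L110–L113, p.14 L1)] -/
theorem coeff_pair_eq_zero_of_dominant {T : Finset (Fin N)} (hT : IsSpanningTree E T) (hTA : T ⊆ A) (hABT : A \ B ⊆ T)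
    (hBT : (B ∩ T).card = edgeRank E B) (hPe : Pe ⊆ A) {l : Fin N} (hlPe : l ∈ Pe) (hlB : l ∉ B)
    (hcut : ¬ (edgeGraph E (A.erase l)).Reachable u w) :
    coeff (∑ e' ∈ Tᶜ, Finsupp.single e' 1 + Finsupp.single l 1)
      (kirchhoffPolynomial ℝ E * lineSum ℝ Pe - twoTreePolynomial ℝ E u w) = 0 := by
  classical
  have hlT : l ∈ T := hABT (Finset.mem_sdiff.2 ⟨hPe hlPe, hlB⟩)
  set F := T.erase l with hF
  have hTF : T = insert l F := (Finset.insert_erase hlT).symm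
  have hlF : l ∉ F := Finset.notMem_erase l T
  have hF2 : IsTwoTree E F := hT.isTwoTree_erase hlT
  have hd : ∑ e' ∈ Tᶜ, Finsupp.single e' (1 : ℕ) + Finsupp.single l 1 = ∑ e' ∈ Fᶜ, Finsupp.single e' 1 :=
    (compl_add_single_eq_compl_iff T F l).2 ⟨hlF, hTF⟩
  have hcross : ¬ (edgeGraph E F).Reachable (E l).1 (E l).2 :=
    ((hF2.isSpanningTree_insert_iff l).1 (hTF ▸ hT)).2
  -- `l` is the only line of `Pe` crossing `F`
  have huniq : (Pe.filter fun l' => ¬ (edgeGraph E F).Reachable (E l').1 (E l').2) = {l} := by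
    refine Finset.eq_singleton_iff_unique_mem.2 ⟨Finset.mem_filter.2 ⟨hlPe, hcross⟩, fun l' hl' => ?_⟩
    rw [Finset.mem_filter] at hl'
    obtain ⟨hl'Pe, hl'cross⟩ := hl'
    by_contra hne
    by_cases hl'B : l' ∈ B
    · have hBTF : B ∩ T ⊆ F := fun e he => by
        rw [hF, Finset.mem_erase]
        exact ⟨fun h => hlB (h ▸ (Finset.mem_inter.1 he).1), (Finset.mem_inter.1 he).2⟩
      exact hl'cross ((reachable_inter_of_mem hT hBT hl'B).mono (edgeGraph_mono hBTF))
    · have hl'F : l' ∈ F := by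
        rw [hF, Finset.mem_erase]
        exact ⟨hne, hABT (Finset.mem_sdiff.2 ⟨hPe hl'Pe, hl'B⟩)⟩
      exact hl'cross (SimpleGraph.ConnectedComponent.exact (connectedComponentMk_fst_eq E hl'F))
  -- `F` separates `u` from `w`
  have hsep : IsSepTwoTree E u w F := by
    refine ⟨hF2, fun h => hcut (h.mono (edgeGraph_mono ?_))⟩
    intro e he
    rw [hF, Finset.mem_erase] at he
    exact Finset.mem_erase.2 ⟨he.1, hTA he.2⟩
  rw [hd, coeff_kirchhoff_mul_lineSum_sub_twoTree ℝ u w hF2, huniq, Finset.card_singleton, if_pos hsep]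
  norm_num

/-- **«S − V z_e по порядку не превосходит δ²V»** ⟦S − V z_e is of order at most δ²V⟧ — EVERY monomial of `V·z_e − S` has weight at
least `ℓ(A) + ℓ(B) + 2 = ord(V) + 2` along `β = 𝟙_A + 𝟙_B`, under the abstract form of the QED hypotheses: `A` (the lines with
`β ≥ 1`: «G′, P₁, P₂») reaches every vertex (`rk A = V`), `B ⊆ A` (the lines of `G′`, `β = 2`), `ℓ(A) = ℓ(B)` («P₁, P₂ и любое
1-дерево G′» form a 1-tree), the electron lines `Pe` lie in `A` («z_l тоже по порядку не больше δ (потому что l — электронная линия)»)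
and join `u` to `w`, and every electron line outside `G′` is a `u–w` bridge of `A`. Proof as printed: a monomial `z_T z_l` with
`T` non-dominant has `z_T` of order `≥ δ·V` and `z_l` of order `≥ δ`; with `l ∈ G′`, `z_l` has order `δ²`; and the dominant pairs
with `l ∉ G′` cancel against `S` (`coeff_pair_eq_zero_of_dominant`). [cite: Volkov2016, §5.2 p.1176–1177 (PDF p.13 L106–L113, p.14 L1–L3)] -/
theorem le_linPair_of_mem_support_sub (hA : edgeRank E A = V) (hBA : B ⊆ A) (hAB : loopNumber E A = loopNumber E B)
    (hPe : Pe ⊆ A) (hP : (edgeGraph E Pe).Reachable u w)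
    (hcut : ∀ l ∈ Pe, l ∉ B → ¬ (edgeGraph E (A.erase l)).Reachable u w) {d : Fin N →₀ ℕ}
    (hd : d ∈ (kirchhoffPolynomial ℝ E * lineSum ℝ Pe - twoTreePolynomial ℝ E u w).support) :
    (loopNumber E A : ℝ) + loopNumber E B + 2 ≤ linPair (castExp d) (fun e => setIndicator A e + setIndicator B e) := by
  classical
  rw [mem_support_iff] at hd
  -- the monomial occurs in `V·z_e`
  have hVz : coeff d (kirchhoffPolynomial ℝ E * lineSum ℝ Pe) ≠ 0 := by
    intro h0
    rw [coeff_sub, h0, zero_sub, neg_ne_zero, coeff_twoTreePolynomial] at hd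
    split_ifs at hd with hF
    · obtain ⟨F, hF, rfl⟩ := hF
      rw [coeff_kirchhoff_mul_lineSum_twoTree ℝ hF.1, Nat.cast_eq_zero] at h0
      have h1 := one_le_card_filter_crossing_of_isSepTwoTree hF hP
      omega
    · exact hd rfl
  obtain ⟨T, l, hT, hlPe, rfl⟩ := exists_pair_of_coeff_kirchhoff_mul_lineSum_ne_zero ℝ hVz
  rw [linPair_castExp_pair_twoLevel]
  have hlA : setIndicator A l = 1 := if_pos (hPe hlPe)
  have hA1 := loopNumber_le_card_sdiff hT A
  have hB1 := loopNumber_le_card_sdiff hT B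
  have hA1' : (loopNumber E A : ℝ) ≤ (A \ T).card := by exact_mod_cast hA1
  have hB1' : (loopNumber E B : ℝ) ≤ (B \ T).card := by exact_mod_cast hB1
  by_cases hlB : l ∈ B
  · have hlB' : setIndicator B l = 1 := if_pos hlB
    rw [hlA, hlB']
    linarith
  · have hlB' : setIndicator B l = 0 := if_neg hlB
    rw [hlA, hlB', add_zero]
    -- either `T` is not dominant (one more chord in `A` or `B`), or the pair cancels
    by_cases hdom : (A \ T).card + (B \ T).card = loopNumber E A + loopNumber E B
    · obtain ⟨hTA, hABT, hBT⟩ := dominant_tree hT hA hBA hAB hdom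
      exact absurd (coeff_pair_eq_zero_of_dominant hT hTA hABT hBT hPe hlPe hlB (hcut l hlPe hlB)) hd
    · have h : loopNumber E A + loopNumber E B + 1 ≤ (A \ T).card + (B \ T).card := by omega
      have h' : (loopNumber E A : ℝ) + loopNumber E B + 1 ≤ (A \ T).card + (B \ T).card := by exact_mod_cast h
      linarith

/-- The ray order is invariant under negation (`W = S − V z_e` vs `V z_e − S`). [folklore] -/
private theorem rayOrder_neg {n : ℕ} (p : MvPolynomial (Fin n) ℝ) (β : Fin n → ℝ) : rayOrder (-p) β = rayOrder p β := by
  unfold rayOrder exps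
  simp only [neg_eq_zero, support_neg]

/-- `W = S − V·z_e` is the negative of `V·z_e − S`. [cite: Volkov2016, §5.1 p.1174 (W = S − V z_e)] -/
theorem wPolynomial_eq_neg (R : Type*) [CommRing R] (u w : Fin (V + 1)) (P : Finset (Fin N)) :
    wPolynomial R E u w P = -(kirchhoffPolynomial R E * lineSum R P - twoTreePolynomial R E u w) := by
  rw [wPolynomial, neg_sub]

/-- **«S − V z_e по порядку не превосходит δ²V» in order form**: under the hypotheses of `le_linPair_of_mem_support_sub`, if `W ≠ 0`
then `ord_β(W) ≥ ord_β(V) + 2` along `β = 𝟙_A + 𝟙_B` (`ord_β(V) = ℓ(A) + ℓ(B)`, `rayOrder_kirchhoffPolynomial_twoLevel_eq`).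
[cite: Volkov2016, §5.2 p.1176–1177 (PDF p.13 L29 «W/V ≍ δ²», L106–L113; p.14 L1–L3)] -/
theorem rayOrder_kirchhoffPolynomial_add_two_le_rayOrder_wPolynomial (hA : edgeRank E A = V) (hBA : B ⊆ A)
    (hAB : loopNumber E A = loopNumber E B) (hPe : Pe ⊆ A) (hP : (edgeGraph E Pe).Reachable u w)
    (hcut : ∀ l ∈ Pe, l ∉ B → ¬ (edgeGraph E (A.erase l)).Reachable u w) (hW : wPolynomial ℝ E u w Pe ≠ 0) :
    rayOrder (kirchhoffPolynomial ℝ E) (fun e => setIndicator A e + setIndicator B e) + 2 ≤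
      rayOrder (wPolynomial ℝ E u w Pe) (fun e => setIndicator A e + setIndicator B e) := by
  have hne : kirchhoffPolynomial ℝ E * lineSum ℝ Pe - twoTreePolynomial ℝ E u w ≠ 0 := by
    rw [wPolynomial_eq_neg, neg_ne_zero] at hW
    exact hW
  rw [wPolynomial_eq_neg, rayOrder_neg, rayOrder_kirchhoffPolynomial_twoLevel_eq hA hBA, rayOrder_eq_inf' hne]
  exact Finset.le_inf' _ _ fun d hd => le_linPair_of_mem_support_sub hA hBA hAB hPe hP hcut hd

/-! ### «Остается привести пример пары (T;l), для которой значение не меньше δ²V»: exactness from a witness pair -/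

/-- **A squared monomial is never cancelled**: for a spanning 1-tree `T` and an electron line `l ∈ Pe` which is a CHORD of `T`, the
monomial `X^{χ_T + 𝟙_l}` (with `z_l²`) occurs in `V·z_e − S`, hence `ord_β(V·z_e − S) ≤ |A ∖ T| + |B ∖ T| + β_l`.
[cite: Volkov2016, §5.2 p.1177 (PDF p.14 L3–L6)] -/
theorem rayOrder_sub_le_of_chord {T : Finset (Fin N)} (hT : IsSpanningTree E T) {l : Fin N} (hlPe : l ∈ Pe) (hlT : l ∉ T) :
    rayOrder (kirchhoffPolynomial ℝ E * lineSum ℝ Pe - twoTreePolynomial ℝ E u w)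
        (fun e => setIndicator A e + setIndicator B e) ≤
      ((A \ T).card : ℝ) + (B \ T).card + (setIndicator A l + setIndicator B l) := by
  classical
  set d := ∑ e' ∈ Tᶜ, Finsupp.single e' (1 : ℕ) + Finsupp.single l 1 with hdd
  have hS : coeff d (twoTreePolynomial ℝ E u w) = 0 :=
    coeff_twoTreePolynomial_eq_zero_of_two_le ℝ u w (l := l) (by rw [hdd, compl_add_single_apply_of_not_mem hlT])
  have hVz : coeff d (kirchhoffPolynomial ℝ E * lineSum ℝ Pe) ≠ 0 := by
    rw [coeff_kirchhoff_mul_lineSum, Nat.cast_ne_zero]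
    exact (card_filter_pairs_pos hT hlPe).ne'
  have hmem : d ∈ (kirchhoffPolynomial ℝ E * lineSum ℝ Pe - twoTreePolynomial ℝ E u w).support := by
    rw [mem_support_iff, coeff_sub, hS, sub_zero]
    exact hVz
  have hne : kirchhoffPolynomial ℝ E * lineSum ℝ Pe - twoTreePolynomial ℝ E u w ≠ 0 := ne_zero_iff.2 ⟨d, mem_support_iff.1 hmem⟩
  rw [rayOrder_eq_inf' hne, ← linPair_castExp_pair_twoLevel]
  exact Finset.inf'_le _ hmem

/-- **«W/V ≍ δ²» in order form, from a witness**: under the hypotheses of `le_linPair_of_mem_support_sub`, a pair (spanning 1-tree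
`T`, electron chord `l ∉ T`) of weight exactly `ℓ(A) + ℓ(B) + 2` makes the bound sharp: `ord_β(W) = ord_β(V) + 2`.
[cite: Volkov2016, §5.2 p.1176–1177 (PDF p.13 L29, p.14 L3–L6)] -/
theorem rayOrder_wPolynomial_eq_of_witness (hA : edgeRank E A = V) (hBA : B ⊆ A) (hAB : loopNumber E A = loopNumber E B)
    (hPe : Pe ⊆ A) (hP : (edgeGraph E Pe).Reachable u w)
    (hcut : ∀ l ∈ Pe, l ∉ B → ¬ (edgeGraph E (A.erase l)).Reachable u w)
    {T : Finset (Fin N)} (hT : IsSpanningTree E T) {l : Fin N} (hlPe : l ∈ Pe) (hlT : l ∉ T)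
    (hwt : ((A \ T).card : ℝ) + (B \ T).card + (setIndicator A l + setIndicator B l) = loopNumber E A + loopNumber E B + 2) :
    rayOrder (wPolynomial ℝ E u w Pe) (fun e => setIndicator A e + setIndicator B e) =
      rayOrder (kirchhoffPolynomial ℝ E) (fun e => setIndicator A e + setIndicator B e) + 2 := by
  have hle := rayOrder_sub_le_of_chord (u := u) (w := w) (A := A) (B := B) hT hlPe hlT
  rw [hwt] at hle
  have hW : wPolynomial ℝ E u w Pe ≠ 0 := by
    rw [wPolynomial_eq_neg, neg_ne_zero]
    classical
    refine ne_zero_iff.2 ⟨∑ e' ∈ Tᶜ, Finsupp.single e' (1 : ℕ) + Finsupp.single l 1, ?_⟩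
    rw [coeff_sub, coeff_twoTreePolynomial_eq_zero_of_two_le ℝ u w (l := l) (by rw [compl_add_single_apply_of_not_mem hlT]),
      sub_zero, coeff_kirchhoff_mul_lineSum, Nat.cast_ne_zero]
    exact (card_filter_pairs_pos hT hlPe).ne'
  have hge := rayOrder_kirchhoffPolynomial_add_two_le_rayOrder_wPolynomial hA hBA hAB hPe hP hcut hW
  rw [wPolynomial_eq_neg, rayOrder_neg] at hge ⊢
  rw [rayOrder_kirchhoffPolynomial_twoLevel_eq hA hBA] at hge ⊢
  exact le_antisymm hle hge

end Order

/-! ## «это можно сделать для любого G»: two witness pairs that every IR configuration of a QED graph supplies -/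

section Witness

variable {u w : Fin (V + 1)} {A B Pe : Finset (Fin N)}

/-- **Witness 1 — an electron line of `G′` lying on a cycle of `G′`** (`l ∈ B`, `rk(B ∖ l) = rk B`; e.g. any electron line under an
internal photon of `G′`): Kruskal's tree for `B ∖ l ⊆ B ⊆ A` is a dominant 1-tree avoiding `l`, and the pair `(T; l)` has weight
`ℓ(A) + ℓ(B) + 2` (`z_T ≍ δ^{ord V}`, `z_l ≍ δ²`). [cite: Volkov2016, §5.2 p.1177 (PDF p.14 L3–L6)] -/
theorem exists_witness_of_edgeRank_erase_eq (hA : edgeRank E A = V) (hBA : B ⊆ A) {l : Fin N} (hlB : l ∈ B)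
    (hrk : edgeRank E (B.erase l) = edgeRank E B) :
    ∃ T : Finset (Fin N), IsSpanningTree E T ∧ l ∉ T ∧
      ((A \ T).card : ℝ) + (B \ T).card + (setIndicator A l + setIndicator B l) = loopNumber E A + loopNumber E B + 2 := by
  have hconn := isConnectedEdgeList_of_edgeRank_eq hA
  obtain ⟨T, hT, h1, h2, h3⟩ := exists_isSpanningTree_nested hconn (Finset.erase_subset l B) hBA
  have hlT : l ∉ T := by
    intro hlT
    have hsub : T ∩ B.erase l = (T ∩ B).erase l := by
      ext e
      simp only [Finset.mem_inter, Finset.mem_erase]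
      tauto
    have hmem : l ∈ T ∩ B := Finset.mem_inter.2 ⟨hlT, hlB⟩
    rw [hsub, Finset.card_erase_of_mem hmem, hrk] at h1
    have hpos : 0 < (T ∩ B).card := Finset.card_pos.2 ⟨l, hmem⟩
    omega
  refine ⟨T, hT, hlT, ?_⟩
  have hA' := Finset.card_sdiff_add_card_inter A T
  have hB' := Finset.card_sdiff_add_card_inter B T
  rw [Finset.inter_comm] at h2 h3
  have hrA := edgeRank_le_card E A
  have hrB := edgeRank_le_card E B
  have e1 : (A \ T).card = loopNumber E A := by unfold loopNumber; omega
  have e2 : (B \ T).card = loopNumber E B := by unfold loopNumber; omega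
  rw [e1, e2, show setIndicator A l = 1 from if_pos (hBA hlB), show setIndicator B l = 1 from if_pos hlB]
  ring

/-- A dominant 1-tree exists (Kruskal's tree for `B ⊆ A`). [cite: Volkov2016, §5.2 p.1175 (PDF p.12 L92–L94); Panzer2022, §2.2 Lemma 2.8] -/
theorem exists_dominant_tree (hA : edgeRank E A = V) (hBA : B ⊆ A) :
    ∃ T : Finset (Fin N), IsSpanningTree E T ∧ (A \ T).card + (B \ T).card = loopNumber E A + loopNumber E B := by
  have hconn := isConnectedEdgeList_of_edgeRank_eq hA
  obtain ⟨T, hT, -, h2, h3⟩ := exists_isSpanningTree_nested hconn (Finset.empty_subset B) hBA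
  refine ⟨T, hT, ?_⟩
  have hA' := Finset.card_sdiff_add_card_inter A T
  have hB' := Finset.card_sdiff_add_card_inter B T
  rw [Finset.inter_comm] at h2 h3
  have hrA := edgeRank_le_card E A
  have hrB := edgeRank_le_card E B
  unfold loopNumber
  omega

/-- **Witness 2 — a `β = 0` line (a photon outside `G′`) over an electron line outside `G′`** (`f ∉ A`, `l ∈ A ∖ B`, the endpoints
of `f` disconnected in `A ∖ l`; e.g. any photon outside `G′` and any electron line of `P₁ ∪ P₂` under it): replacing `l` by `f` in a
dominant tree gives a 1-tree `T` with one more chord in `A`, and the pair `(T; l)` has weight `ℓ(A) + ℓ(B) + 2` (`z_T ≍ δ^{ord V + 1}`,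
`z_l ≍ δ`). This covers the case `G′` = a single vertex (`B = ∅`) as well. [cite: Volkov2016, §5.2 p.1177 (PDF p.14 L3–L6)] -/
theorem exists_witness_of_outer_line (hA : edgeRank E A = V) (hBA : B ⊆ A) (hAB : loopNumber E A = loopNumber E B)
    {l f : Fin N} (hl : l ∈ A \ B) (hfA : f ∉ A) (hf : ¬ (edgeGraph E (A.erase l)).Reachable (E f).1 (E f).2) :
    ∃ T : Finset (Fin N), IsSpanningTree E T ∧ l ∉ T ∧
      ((A \ T).card : ℝ) + (B \ T).card + (setIndicator A l + setIndicator B l) = loopNumber E A + loopNumber E B + 2 := by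
  obtain ⟨T₀, hT₀, hdom⟩ := exists_dominant_tree hA hBA
  obtain ⟨hT₀A, hABT₀, -⟩ := dominant_tree hT₀ hA hBA hAB hdom
  have hlT₀ : l ∈ T₀ := hABT₀ hl
  have hlA : l ∈ A := (Finset.mem_sdiff.1 hl).1
  have hlB : l ∉ B := (Finset.mem_sdiff.1 hl).2
  set F := T₀.erase l with hF
  have hF2 : IsTwoTree E F := hT₀.isTwoTree_erase hlT₀
  have hFA : F ⊆ A.erase l := fun e he => by
    rw [hF, Finset.mem_erase] at he
    exact Finset.mem_erase.2 ⟨he.1, hT₀A he.2⟩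
  have hfF : f ∉ F := fun h => hfA (Finset.mem_of_mem_erase (hFA h))
  have hcross : ¬ (edgeGraph E F).Reachable (E f).1 (E f).2 := fun h => hf (h.mono (edgeGraph_mono hFA))
  have hT : IsSpanningTree E (insert f F) := (hF2.isSpanningTree_insert_iff f).2 ⟨hfF, hcross⟩
  have hlf : l ≠ f := fun h => hfA (h ▸ hlA)
  have hlT : l ∉ insert f F := by
    rw [Finset.mem_insert, hF, Finset.mem_erase]
    push Not
    exact ⟨hlf, fun h => absurd rfl h⟩
  refine ⟨insert f F, hT, hlT, ?_⟩
  have hA1 : A \ insert f F = insert l (A \ T₀) := by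
    rw [Finset.sdiff_insert_of_notMem hfA, hF, Finset.sdiff_erase hlA]
  have hB1 : B \ insert f F = B \ T₀ := by
    rw [Finset.sdiff_insert_of_notMem (fun h => hfA (hBA h)), hF]
    ext e
    rw [Finset.mem_sdiff, Finset.mem_sdiff, Finset.mem_erase]
    constructor
    · rintro ⟨heB, h⟩
      exact ⟨heB, fun heT => h ⟨fun hel => hlB (hel ▸ heB), heT⟩⟩
    · rintro ⟨heB, h⟩
      exact ⟨heB, fun h' => h h'.2⟩
  have hA0 := loopNumber_le_card_sdiff hT₀ A
  have hB0 := loopNumber_le_card_sdiff hT₀ B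
  have eA : (A \ T₀).card = loopNumber E A := by omega
  have eB : (B \ T₀).card = loopNumber E B := by omega
  rw [hA1, hB1, Finset.card_insert_of_notMem (fun h => (Finset.mem_sdiff.1 h).2 hlT₀), eB, Nat.cast_add, eA,
    show setIndicator A l = 1 from if_pos hlA, show setIndicator B l = 0 from if_neg hlB]
  push_cast
  ring

/-- **«W/V ≍ δ²» (order form), QED reading 1**: under the hypotheses of `le_linPair_of_mem_support_sub`, if some electron line of
`G′` lies on a cycle of `G′` (`l ∈ Pe ∩ B`, `rk(B ∖ l) = rk B`) then `ord_β(W) = ord_β(V) + 2`.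
[cite: Volkov2016, §5.2 p.1176–1177 (PDF p.13 L29, p.14 L3–L6)] -/
theorem rayOrder_wPolynomial_eq_of_inner_cycle (hA : edgeRank E A = V) (hBA : B ⊆ A) (hAB : loopNumber E A = loopNumber E B)
    (hPe : Pe ⊆ A) (hP : (edgeGraph E Pe).Reachable u w)
    (hcut : ∀ l ∈ Pe, l ∉ B → ¬ (edgeGraph E (A.erase l)).Reachable u w)
    {l : Fin N} (hlPe : l ∈ Pe) (hlB : l ∈ B) (hrk : edgeRank E (B.erase l) = edgeRank E B) :
    rayOrder (wPolynomial ℝ E u w Pe) (fun e => setIndicator A e + setIndicator B e) =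
      rayOrder (kirchhoffPolynomial ℝ E) (fun e => setIndicator A e + setIndicator B e) + 2 := by
  obtain ⟨T, hT, hlT, hwt⟩ := exists_witness_of_edgeRank_erase_eq hA hBA hlB hrk
  exact rayOrder_wPolynomial_eq_of_witness hA hBA hAB hPe hP hcut hT hlPe hlT hwt

/-- **«W/V ≍ δ²» (order form), QED reading 2**: under the hypotheses of `le_linPair_of_mem_support_sub`, if some line `f` outside `A`
(a photon outside `G′`) has its endpoints disconnected in `A ∖ l` for an electron line `l ∉ G′` (a photon of `G/G′` over a line of
`P₁ ∪ P₂`) then `ord_β(W) = ord_β(V) + 2`. [cite: Volkov2016, §5.2 p.1176–1177 (PDF p.13 L29, p.14 L3–L6)] -/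
theorem rayOrder_wPolynomial_eq_of_outer_line (hA : edgeRank E A = V) (hBA : B ⊆ A) (hAB : loopNumber E A = loopNumber E B)
    (hPe : Pe ⊆ A) (hP : (edgeGraph E Pe).Reachable u w)
    (hcut : ∀ l ∈ Pe, l ∉ B → ¬ (edgeGraph E (A.erase l)).Reachable u w)
    {l f : Fin N} (hlPe : l ∈ Pe) (hlB : l ∉ B) (hfA : f ∉ A) (hf : ¬ (edgeGraph E (A.erase l)).Reachable (E f).1 (E f).2) :
    rayOrder (wPolynomial ℝ E u w Pe) (fun e => setIndicator A e + setIndicator B e) =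
      rayOrder (kirchhoffPolynomial ℝ E) (fun e => setIndicator A e + setIndicator B e) + 2 := by
  obtain ⟨T, hT, hlT, hwt⟩ := exists_witness_of_outer_line hA hBA hAB (Finset.mem_sdiff.2 ⟨hPe hlPe, hlB⟩) hfA hf
  exact rayOrder_wPolynomial_eq_of_witness hA hBA hAB hPe hP hcut hT hlPe hlT hwt

end Witness

/-! ## «W/V ≍ δ²» in the sense of footnote 16: `δ^{−2}·W(z(δ))/V(z(δ))` has a finite NEGATIVE limit along `z_i = c_i δ^{β_i}` -/

section Asymptotics

open Filter
open scoped _root_.Topology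

variable {u w : Fin (V + 1)} {Pe : Finset (Fin N)}

/-- The initial form of `V` along any `β` is positive on the open positive orthant (all coefficients of `V` are `1`). (Re-proved
from `MatrixTreeTheorem`; the companion `OneTreePolynomialRayOrder` has the same statement under connectivity.) [cite: Volkov2016, §5.2 p.1175 (PDF p.12 L92–L98) with App. A (p.1185)] -/
private theorem eval_initForm_kirchhoff_pos (hconn : IsConnectedEdgeList E) (β : Fin N → ℝ) {c : Fin N → ℝ}
    (hc : ∀ i, 0 < c i) : 0 < eval c (initForm (kirchhoffPolynomial ℝ E) β) := by
  have hne : kirchhoffPolynomial ℝ E ≠ 0 := kirchhoffPolynomial_ne_zero E ℝ hconn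
  have hsupp : (initForm (kirchhoffPolynomial ℝ E) β).support.Nonempty :=
    support_nonempty.2 (initForm_ne_zero hne β)
  rw [eval_initForm, ← support_initForm]
  refine Finset.sum_pos (fun r hr => ?_) hsupp
  rw [support_initForm, Finset.mem_filter] at hr
  rw [coeff_kirchhoffPolynomial_of_mem_support E ℝ hr.1, one_mul]
  exact Finset.prod_pos fun i _ => pow_pos (hc i) _

/-- **The initial form of `W` is negative on the open positive orthant** (every coefficient of `W` is negative — the companion's
`coeff_wPolynomial_neg_of_mem_support` — so no cancellation can occur among the δ-dominant monomials of `W`: «все коэффициенты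
полинома S − V z_e отрицательны, это обосновывает возможность использования Утверждения 1»). [cite: Volkov2016, §5.2 p.1177 (PDF p.14 L6–L12)] -/
theorem eval_initForm_wPolynomial_neg (hP : (edgeGraph E Pe).Reachable u w) (hW : wPolynomial ℝ E u w Pe ≠ 0) (β : Fin N → ℝ)
    {c : Fin N → ℝ} (hc : ∀ i, 0 < c i) : eval c (initForm (wPolynomial ℝ E u w Pe) β) < 0 := by
  have hsupp : (initForm (wPolynomial ℝ E u w Pe) β).support.Nonempty := support_nonempty.2 (initForm_ne_zero hW β)
  rw [eval_initForm, ← support_initForm]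
  refine Finset.sum_neg (fun r hr => ?_) hsupp
  rw [support_initForm, Finset.mem_filter] at hr
  exact mul_neg_of_neg_of_pos (coeff_wPolynomial_neg_of_mem_support ℝ hP hr.1) (Finset.prod_pos fun i _ => pow_pos (hc i) _)

/-- **«W/V ≍ δ²»** ⟦footnote 16: «f(δ) ≍ g(δ) означает, что 0 < C₁ < |f(δ)/g(δ)| < C₂ в некоторой окрестности предельного значения δ»⟧:
whenever `ord_β(W) = ord_β(V) + 2` (the two QED readings above), along `z_i = c_i δ^{β_i}` (`c_i > 0`) the quotient
`δ^{−2} · W(z(δ))/V(z(δ))` tends, as `δ → 0⁺`, to `W_β(c)/V_β(c)` — the ratio of the initial forms, finite and NEGATIVE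
(`div_eval_initForm_neg`). [cite: Volkov2016, §5.2 p.1176 (PDF p.13 L29 «W/V ≍ δ²») with footnote 16 (PDF p.12 L96–L98) and §5.1 (19)] -/
theorem tendsto_wPolynomial_div_kirchhoffPolynomial {β : Fin N → ℝ} (hconn : IsConnectedEdgeList E)
    (h : rayOrder (wPolynomial ℝ E u w Pe) β = rayOrder (kirchhoffPolynomial ℝ E) β + 2) {c : Fin N → ℝ} (hc : ∀ i, 0 < c i) :
    Tendsto (fun δ : ℝ => δ ^ (-(2 : ℝ)) *
        (eval (fun i => c i * δ ^ β i) (wPolynomial ℝ E u w Pe) / eval (fun i => c i * δ ^ β i) (kirchhoffPolynomial ℝ E)))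
      (𝓝[>] 0) (𝓝 (eval c (initForm (wPolynomial ℝ E u w Pe) β) / eval c (initForm (kirchhoffPolynomial ℝ E) β))) := by
  have hW := tendsto_rpow_neg_rayOrder_mul_eval (wPolynomial ℝ E u w Pe) β c
  have hV := tendsto_rpow_neg_rayOrder_mul_eval (kirchhoffPolynomial ℝ E) β c
  have hVpos := eval_initForm_kirchhoff_pos hconn β hc
  have hev : (fun δ : ℝ => δ ^ (-rayOrder (wPolynomial ℝ E u w Pe) β) * eval (fun i => c i * δ ^ β i) (wPolynomial ℝ E u w Pe) /
      (δ ^ (-rayOrder (kirchhoffPolynomial ℝ E) β) * eval (fun i => c i * δ ^ β i) (kirchhoffPolynomial ℝ E))) =ᶠ[𝓝[>] 0]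
      fun δ : ℝ => δ ^ (-(2 : ℝ)) *
        (eval (fun i => c i * δ ^ β i) (wPolynomial ℝ E u w Pe) / eval (fun i => c i * δ ^ β i) (kirchhoffPolynomial ℝ E)) := by
    filter_upwards [self_mem_nhdsWithin] with δ (hδ : 0 < δ)
    rw [mul_div_mul_comm, ← Real.rpow_sub hδ, h]
    congr 1
    ring_nf
  exact (tendsto_congr' hev).1 (hW.div hV hVpos.ne')

/-- The limit in `tendsto_wPolynomial_div_kirchhoffPolynomial` is negative (in particular non-zero: «≍», not merely «O»).
[cite: Volkov2016, §5.2 p.1176–1177 (PDF p.13 L29, p.14 L6–L12) with footnote 16] -/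
theorem div_eval_initForm_neg (hconn : IsConnectedEdgeList E) (hP : (edgeGraph E Pe).Reachable u w)
    (hW : wPolynomial ℝ E u w Pe ≠ 0) (β : Fin N → ℝ) {c : Fin N → ℝ} (hc : ∀ i, 0 < c i) :
    eval c (initForm (wPolynomial ℝ E u w Pe) β) / eval c (initForm (kirchhoffPolynomial ℝ E) β) < 0 :=
  div_neg_of_neg_of_pos (eval_initForm_wPolynomial_neg hP hW β hc) (eval_initForm_kirchhoff_pos hconn β hc)

end Asymptotics

/-! ## Appended (g30, additions only): THE VALUATION OF THE ON-SHELL ATOM ON EVERY RAY, for self-energy words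

For a SELF-ENERGY WORD — an edge list whose marked lines `lep 0, …, lep (V−1)` form the lepton path `0 — 1 — ⋯ — V` (line `lep k` joins
the vertices `k` and `k+1`; `u = 0`, `w = V`) and whose other non-degenerate lines are the photons — and for EVERY real weight vector `y`,
the ray order of `𝒲 := V·z_e − S` (= `−W` of ЖЭТФ §5.1; = the cell's `𝒲 = U·Σ_{l∈P} z_l − U_•`, T1-EXPONENTS §2 L1) is
`ord_y(𝒲) = ord_y(V) + min_{i photon} max(y′_i, 2y′_i − y_i)`, `y′_i := min_{l ∈ LPath(i)} y_l` — the valuation shadow of NPB 961 Lemma 3.4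
WITH footnote 23 («|W(z)| ≍ max_i (z′_i)²/max(z′_i, z_i)», `z′_i = max_{l∈LPath(i)} z_l`, two-sided) read along `z = δ^y`, here PROVED
combinatorially for the 2016 polynomial `S − V z_e` from the exact monomial structure above (no circuit theory, no Kirchhoff identification
`S/V = Z`). This is the closed form the cell's ORACLE-RULE (4c) / T1 L1 (b) adopted as DERIVED + machine-checked; below it is a theorem for
every word and every ray.

SOURCE for this part, VERBATIM [Volkov2020] (NPB 961 (2020) 115232 = arXiv:1912.04885v4, tex `iclos_arxiv.tex` held by the cell): §3.2 **Lemma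
3.4** (journal p.12; tex l.362–372): «The following inequality is satisfied [fn 23: This inequality works in both directions too.] for (2.3):
|W(z)| ≥ C·max_{i∈Ph(E(G))} (z′_i)²/max(z′_i, z_i), (3.3) where z′_i = max_{l∈LPath(i)} z_l, C > 0 is some constant depending only on the structure
of the graph (and m).»; proof (tex l.373–393): «Take i on which the maximum (3.3) is reached. By Z_i(z) we denote the resistance … of the electric
circuit with the graph that is obtained from G by removing all photon lines except i … It is obvious that Z(z) ≤ Z_i(z) ≤ Z₀(z) … Thus, |W(z)| ≥
m²(Z₀(z) − Z_i(z)) = … = m²(z″_i)²/(z″_i + z_i)»; §2.2.2 eq. (2.4) «W(z) = m²(Z(z) − Z₀(z))»; §2.1 «LPath(i)», «Lept(E(G))», «Ph(E(G))». Along a ray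
`z = c·δ^y` the right-hand side of (3.3) is `≍ δ^{min_i max(y′_i, 2y′_i − y_i)}`, `y′_i = min_{l∈LPath(i)} y_l`; with footnote 23 this is the
VALUATION of `W`, and `W_{2016} = S − V z_e = V·(Z − Z₀)` carries the extra `ord(V)`. The theorem below proves that valuation for the POLYNOMIAL
`V·z_e − S` directly; V3b's `Volkov2020/OnShellDenominatorCircuit.lemma34_two_sided` proves the analytic two-sided (3.3) in the circuit model.

MODEL OF A WORD (hypotheses, no structure): `lep : Fin V → Fin N` injective with `E (lep k) = (k.castSucc, k.succ)` — the lepton path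
`0 — 1 — ⋯ — V` («Lept(E(G))» is a path from the in- to the out-vertex; `u = 0`, `w = Fin.last V`); NEW DEFINITIONS `Over E e k` (line `e` lies
over lepton index `k`: `min endpoint ≤ k < k + 1 ≤ max endpoint`), `lPath E lep e` (= «LPath»: the lepton lines under `e`; `lPath_lep`,
`lep_mem_lPath_iff`), `photons E lep` (= «Ph»: the non-lepton lines with distinct endpoints), `overPairs E lep` (the pairs (photon, lepton index
under it): the index set of `min_i min_{l∈LPath(i)}`). Nothing else is assumed: photons may be attached anywhere (several per vertex, none at
some vertex, parallel), lepton loops are simply absent from the vocabulary (every vertex is on the path).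

WHAT THE KERNEL CERTIFIES in this part (all PROVED): tools — `le_iff_le_of_reachable` (gap lemma), `reachable_of_chain`, `span_inter_eq_of_indep` /
`reachable_inter_of_indep` / `reachable_sdiff_of_forall_erase` (for a forest `T`: `⋂_{e∈O} span(T∖e) = span(T∖O)`, in reachability form),
`reachable_insert_cases` (a new connection through an added line passes through it), `reachable_filter_comp`; optimal trees
`exists_isSpanningTree_sum_compl_eq`, `rayOrder_kirchhoff_le_sum_compl`; **`exists_over_separating`** (the bridge photon of a lepton chord),
**`exists_photon_le_weight_pair`** (LB on the squared monomials), `not_reachable_of_over_of_prefixCut`, `only_crossing_of_not_mem_support`,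
**`exists_mem_support_weight_le`** (UB: for every photon `i` over `k` a monomial of weight `≤ ord(V) + max(y_k, 2y_k − y_i)` — «Z ≤ Z_i ≤ Z₀»),
**`exists_two_crossings`**, **`exists_jump`**, **`exists_photon_le_weight_twoTree`** (LB on the 2-tree monomials: a run of the far component,
a jumping photon of the near component, one exchange), **`exists_pair_le_weight_of_mem_support`** (LB for every monomial), and the closed form
**`rayOrder_kirchhoff_mul_lineSum_sub_eq`** / **`rayOrder_wPolynomial_word_eq`**:
`ord_y(V·z_e − S) = ord_y(W) = ord_y(V) + min_{(i,k) ∈ overPairs} max(y_{lep k}, 2y_{lep k} − y_i)` for every word with a photon and EVERY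
`y : lines → ℝ` (no sign or integrality condition), + the photonwise upper bound `rayOrder_sub_le_of_over`.
NOT CLAIMED in this part: the analytic inequality (3.3) itself with its constant (V3b's file), the identification `S/V = Z` (Kirchhoff), anything
for graphs with lepton loops or for the MIXED atoms of the cell's forest terms (T1 L1 (c)), anything per word of the cell. presearch (g30): the
closed form is the cell's own DERIVED lemma (`tropical/theory/T1-EXPONENTS.md` §2 L1 (b), machine-checked there on {0,…,3}^M rays of 12+ words;
re-checked here by brute force on 15 words of orders 2–8 with random integer rays, 0 mismatches, script `pub-qed-trop-v3-lit-1/g30/l1b_check.py`);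
no printed source states it for the polynomial — cited to its analytic root NPB 961 Lemma 3.4 + fn 23 and to ЖЭТФ §5.1/§5.2 for the objects. -/

section Word

variable {lep : Fin V → Fin N}

/-- «the line `e` lies over the lepton line `k`»: `LPath` membership in index form — the smaller endpoint of `e` is `≤ k` and the larger is
`≥ k + 1` (for a photon `i = (a, b)`, `a < b`, this says `k ∈ [a, b)`, NPB 961 §2.1's `LPath(i)` = the lepton lines between the end points
of photon `i`; for the lepton line `lep j` it says `j = k`). [cite: Volkov2020, §2.1 (LPath(i)); Volkov2016, §5.1 p.1174] -/
def Over (E : Fin N → Fin (V + 1) × Fin (V + 1)) (e : Fin N) (k : Fin V) : Prop :=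
  min ((E e).1 : ℕ) ((E e).2 : ℕ) ≤ (k : ℕ) ∧ (k : ℕ) + 1 ≤ max ((E e).1 : ℕ) ((E e).2 : ℕ)

/-- `Over` is decidable (two inequalities of naturals). [folklore] -/
instance instDecidableOver (E : Fin N → Fin (V + 1) × Fin (V + 1)) (e : Fin N) (k : Fin V) : Decidable (Over E e k) := by
  unfold Over; infer_instance

/-- `LPath(e)` as a set of lines: the lepton lines `lep k` with `e` over `k` («LPath(i) … the set of lepton lines between the vertexes
incident to photon i»). [cite: Volkov2020, §2.1 (LPath(i)) and §3.2 Lemma 3.4 (z′_i = max_{l∈LPath(i)} z_l)] -/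
def lPath (E : Fin N → Fin (V + 1) × Fin (V + 1)) (lep : Fin V → Fin N) (e : Fin N) : Finset (Fin N) :=
  (Finset.univ.filter fun k => Over E e k).image lep

/-- The photons of a word: the lines other than the lepton lines, with distinct endpoints («Ph(E(G))»; a degenerate line would be a
self-loop, which no QED graph has and no spanning forest contains). [cite: Volkov2020, §2.1 (Lept, Ph)] -/
def photons (E : Fin N → Fin (V + 1) × Fin (V + 1)) (lep : Fin V → Fin N) : Finset (Fin N) :=
  Finset.univ.filter fun e => e ∉ Finset.univ.image lep ∧ (E e).1 ≠ (E e).2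

/-- A lepton line `lep j` (joining `j` and `j + 1`) lies over `k` iff `j = k`. [cite: Volkov2020, §2.1 (Lept(E(G)) is a path)] -/
theorem over_lep_iff (hlep : ∀ k, E (lep k) = (Fin.castSucc k, Fin.succ k)) (j k : Fin V) : Over E (lep j) k ↔ j = k := by
  unfold Over
  rw [hlep]
  simp only [Fin.val_castSucc, Fin.val_succ]
  rw [min_eq_left (Nat.le_succ _), max_eq_right (Nat.le_succ _)]
  constructor
  · rintro ⟨h1, h2⟩; exact Fin.ext (by omega)
  · rintro rfl; exact ⟨le_rfl, le_rfl⟩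

/-- `LPath(lep j) = {lep j}`. [cite: Volkov2020, §2.1] -/
theorem lPath_lep (hlep : ∀ k, E (lep k) = (Fin.castSucc k, Fin.succ k)) (j : Fin V) : lPath E lep (lep j) = {lep j} := by
  unfold lPath
  rw [show (Finset.univ.filter fun k => Over E (lep j) k) = {j} from ?_, Finset.image_singleton]
  ext k
  simp [over_lep_iff hlep, eq_comm]

/-- `lep k ∈ LPath(e)` iff `e` lies over `k`. [cite: Volkov2020, §2.1 (LPath(i))] -/
theorem lep_mem_lPath_iff (hinj : Function.Injective lep) (e : Fin N) (k : Fin V) : lep k ∈ lPath E lep e ↔ Over E e k := by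
  unfold lPath
  rw [Finset.mem_image]
  constructor
  · rintro ⟨k', hk', hkk'⟩
    rw [hinj hkk'] at hk'
    exact (Finset.mem_filter.1 hk').2
  · intro h
    exact ⟨k, Finset.mem_filter.2 ⟨Finset.mem_univ _, h⟩, rfl⟩

/-- A predicate on the vertices that agrees across every line of `G` agrees on `G`-reachable vertices. Plumbing
(`IncidenceMatrixRank.forall_mem_apply_fst_eq_iff` + `forall_adj_eq_iff_forall_reachable_eq`). [cite: Biggs1974, Ch. 4 Prop. 4.3 (proof)] -/
private theorem apply_eq_of_reachable {β : Sort*} {G : Finset (Fin N)} (f : Fin (V + 1) → β) (hf : ∀ e ∈ G, f (E e).1 = f (E e).2)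
    {x x' : Fin (V + 1)} (h : (edgeGraph E G).Reachable x x') : f x = f x' :=
  (forall_adj_eq_iff_forall_reachable_eq _ f).1 ((forall_mem_apply_fst_eq_iff E G f).1 hf) x x' h

/-- **Gap lemma**: if no line of `G` lies over `k`, then `G`-reachable vertices lie on the same side of the gap between `k` and `k + 1`.
[cite: Volkov2020, §2.1 (the lepton path and LPath); Biggs1974, Ch. 4 Prop. 4.3 (proof)] -/
theorem le_iff_le_of_reachable {G : Finset (Fin N)} {k : Fin V} (hG : ∀ e ∈ G, ¬ Over E e k) {x x' : Fin (V + 1)}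
    (h : (edgeGraph E G).Reachable x x') : ((x : ℕ) ≤ k ↔ (x' : ℕ) ≤ k) := by
  have := apply_eq_of_reachable (fun v : Fin (V + 1) => ((v : ℕ) ≤ k : Prop)) (fun e he => ?_) h
  · exact Iff.of_eq this
  · have hne := hG e he
    unfold Over at hne
    apply propext
    constructor <;> intro h1 <;> by_contra h2 <;> push Not at h2 <;> apply hne <;> constructor <;> omega

/-- **Chain lemma**: if every lepton line `lep k` with `a ≤ k < b` has its endpoints `F`-joined, then `a ~_F b` (walk up the lepton path).
[cite: Volkov2020, §2.1 (Lept(E(G)) is a path)] -/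
theorem reachable_of_chain {F : Finset (Fin N)} {a b : Fin (V + 1)}
    (hab : a ≤ b) (h : ∀ k : Fin V, (a : ℕ) ≤ k → (k : ℕ) < b → (edgeGraph E F).Reachable (Fin.castSucc k) (Fin.succ k)) :
    (edgeGraph E F).Reachable a b := by
  suffices H : ∀ n : ℕ, ∀ b : Fin (V + 1), (b : ℕ) = a + n →
      (∀ k : Fin V, (a : ℕ) ≤ k → (k : ℕ) < b → (edgeGraph E F).Reachable (Fin.castSucc k) (Fin.succ k)) →
      (edgeGraph E F).Reachable a b from
    H ((b : ℕ) - a) b (by have := Fin.le_def.1 hab; omega) h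
  intro n
  induction n with
  | zero =>
    intro b hb _
    have : a = b := Fin.ext (by omega)
    rw [this]
  | succ n ih =>
    intro b hb h
    have hb0 : b ≠ 0 := by
      intro h0
      rw [h0, Fin.val_zero] at hb
      omega
    obtain ⟨k, hk⟩ := Fin.exists_succ_eq.2 hb0
    have hkv : (b : ℕ) = (k : ℕ) + 1 := by rw [← hk, Fin.val_succ]
    have hkc : ((Fin.castSucc k : Fin (V + 1)) : ℕ) = (a : ℕ) + n := by rw [Fin.val_castSucc]; omega
    have h1 : (edgeGraph E F).Reachable a (Fin.castSucc k) :=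
      ih (Fin.castSucc k) hkc fun k' h1 h2 => h k' h1 (by rw [hkc] at h2; omega)
    have h2 : (edgeGraph E F).Reachable (Fin.castSucc k) (Fin.succ k) := h k (by omega) (by omega)
    rw [← hk]
    exact h1.trans h2

end Word

/-! ### Linear algebra of an independent line set; adding one line; restricting to a component -/

section WordTools

/-- For subsets `A`, `B` of an INDEPENDENT line set `T` (a forest): `span(rows A) ⊓ span(rows B) = span(rows (A ∩ B))` (dimension count:
`|A| + |B| = |A ∪ B| + |A ∩ B|`). [cite: Biggs1974, Ch. 4 Prop. 4.3 with Ch. 5 Prop. 5.4; Oxley2011, §1.1 (independent sets of M(G))] -/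
theorem span_inter_eq_of_indep {T A B : Finset (Fin N)} (hT : edgeRank E T = T.card) (hA : A ⊆ T) (hB : B ⊆ T) :
    Submodule.span ℚ (Set.range (incidenceRows ℚ E A)) ⊓ Submodule.span ℚ (Set.range (incidenceRows ℚ E B)) =
      Submodule.span ℚ (Set.range (incidenceRows ℚ E (A ∩ B))) := by
  set WA := Submodule.span ℚ (Set.range (incidenceRows ℚ E A)) with hWA
  set WB := Submodule.span ℚ (Set.range (incidenceRows ℚ E B)) with hWB
  set WI := Submodule.span ℚ (Set.range (incidenceRows ℚ E (A ∩ B))) with hWI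
  have hle : WI ≤ WA ⊓ WB :=
    le_inf (span_incidenceRows_mono E Finset.inter_subset_left) (span_incidenceRows_mono E Finset.inter_subset_right)
  have hdim := Submodule.finrank_sup_add_finrank_inf_eq WA WB
  have hU : WA ⊔ WB = Submodule.span ℚ (Set.range (incidenceRows ℚ E (A ∪ B))) := (span_incidenceRows_union E A B).symm
  have hrA : Module.finrank ℚ WA = A.card := by
    rw [hWA, ← edgeRank_eq_finrank_span_incidenceRows]; exact edgeRank_eq_card_of_subset hT hA
  have hrB : Module.finrank ℚ WB = B.card := by
    rw [hWB, ← edgeRank_eq_finrank_span_incidenceRows]; exact edgeRank_eq_card_of_subset hT hB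
  have hrU : Module.finrank ℚ ↥(WA ⊔ WB) = (A ∪ B).card := by
    rw [hU, ← edgeRank_eq_finrank_span_incidenceRows]; exact edgeRank_eq_card_of_subset hT (Finset.union_subset hA hB)
  have hrI : Module.finrank ℚ WI = (A ∩ B).card := by
    rw [hWI, ← edgeRank_eq_finrank_span_incidenceRows]
    exact edgeRank_eq_card_of_subset hT (Finset.inter_subset_left.trans hA)
  have hcard := Finset.card_union_add_card_inter A B
  refine (Submodule.eq_of_le_of_finrank_eq hle ?_).symm
  omega

/-- **Joined in `A` and in `B` ⇒ joined in `A ∩ B`** when `A ∪ B` lies in a forest `T` (the relation `𝟙_x − 𝟙_{x′}` lies in both row spans,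
hence in their intersection). [cite: Biggs1974, Ch. 4 Prop. 4.3] -/
theorem reachable_inter_of_indep {T A B : Finset (Fin N)} (hT : edgeRank E T = T.card) (hA : A ⊆ T) (hB : B ⊆ T)
    {x x' : Fin (V + 1)} (ha : (edgeGraph E A).Reachable x x') (hb : (edgeGraph E B).Reachable x x') :
    (edgeGraph E (A ∩ B)).Reachable x x' := by
  rw [reachable_iff_single_sub_single_mem_span] at ha hb ⊢
  rw [← span_inter_eq_of_indep hT hA hB]
  exact ⟨ha, hb⟩

/-- **Exchange core**: in a forest `T`, if `x ~ x′` survives the deletion of each single line of `O ⊆ T`, it survives the deletion of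
all of `O` at once (`⋂_{e∈O} span(T ∖ e) = span(T ∖ O)` for an independent `T`). [cite: Biggs1974, Ch. 5 Prop. 5.4; Oxley2011, §1.1] -/
theorem reachable_sdiff_of_forall_erase {T O : Finset (Fin N)} (hT : edgeRank E T = T.card) (hO : O ⊆ T) {x x' : Fin (V + 1)}
    (h0 : (edgeGraph E T).Reachable x x') (h : ∀ e ∈ O, (edgeGraph E (T.erase e)).Reachable x x') :
    (edgeGraph E (T \ O)).Reachable x x' := by
  classical
  induction O using Finset.induction_on with
  | empty => rw [Finset.sdiff_empty]; exact h0
  | insert e O heO ih =>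
    have hOT : O ⊆ T := (Finset.subset_insert e O).trans hO
    have h1 := ih hOT fun e' he' => h e' (Finset.mem_insert_of_mem he')
    have h2 := h e (Finset.mem_insert_self e O)
    have h3 := reachable_inter_of_indep hT Finset.sdiff_subset (Finset.erase_subset e T) h1 h2
    have hset : T \ O ∩ T.erase e = T \ insert e O := by
      ext f
      simp only [Finset.mem_inter, Finset.mem_sdiff, Finset.mem_erase, Finset.mem_insert]
      tauto
    rw [hset] at h3
    exact h3

/-- **Adding one line**: if `x ~ x′` in `G ∪ {l}` but not in `G`, then the new connection passes through `l = (p, q)`: `x ~_G p` and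
`q ~_G x′`, or `x ~_G q` and `p ~_G x′` (the component indicator of `x` must jump across `l`). [cite: Biggs1974, Ch. 4 Prop. 4.3 (proof)] -/
theorem reachable_insert_cases {G : Finset (Fin N)} {l : Fin N} {x x' : Fin (V + 1)}
    (h : (edgeGraph E (insert l G)).Reachable x x') (hn : ¬ (edgeGraph E G).Reachable x x') :
    ((edgeGraph E G).Reachable x (E l).1 ∧ (edgeGraph E G).Reachable (E l).2 x') ∨
      ((edgeGraph E G).Reachable x (E l).2 ∧ (edgeGraph E G).Reachable (E l).1 x') := by
  classical
  -- the indicator of the `G`-component of `x` must differ at the two ends of `l`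
  have key : ∀ (φ : Fin (V + 1) → Prop), (∀ e ∈ G, φ (E e).1 = φ (E e).2) → φ x ≠ φ x' → φ (E l).1 ≠ φ (E l).2 := by
    intro φ hφ hxx' hl
    apply hxx'
    refine apply_eq_of_reachable φ (fun e he => ?_) h
    rcases Finset.mem_insert.1 he with rfl | heG
    · exact hl
    · exact hφ e heG
  have hφ : ∀ e ∈ G, (edgeGraph E G).Reachable x (E e).1 = (edgeGraph E G).Reachable x (E e).2 := fun e he =>
    propext ⟨fun h1 => h1.trans (SimpleGraph.ConnectedComponent.exact (connectedComponentMk_fst_eq E he)),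
      fun h2 => h2.trans (SimpleGraph.ConnectedComponent.exact (connectedComponentMk_fst_eq E he)).symm⟩
  have hψ : ∀ e ∈ G, (edgeGraph E G).Reachable (E e).1 x' = (edgeGraph E G).Reachable (E e).2 x' := fun e he =>
    propext ⟨fun h1 => (SimpleGraph.ConnectedComponent.exact (connectedComponentMk_fst_eq E he)).symm.trans h1,
      fun h2 => (SimpleGraph.ConnectedComponent.exact (connectedComponentMk_fst_eq E he)).trans h2⟩
  have k1 := key (fun v => (edgeGraph E G).Reachable x v) hφ (by
    intro heq; exact hn (heq ▸ SimpleGraph.Reachable.refl x))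
  have k2 := key (fun v => (edgeGraph E G).Reachable v x') hψ (by
    intro heq; exact hn (heq ▸ SimpleGraph.Reachable.refl x'))
  simp only [ne_eq, eq_iff_iff] at k1 k2
  by_cases hp : (edgeGraph E G).Reachable x (E l).1
  · have hq : ¬ (edgeGraph E G).Reachable x (E l).2 := fun hq => k1 ⟨fun _ => hq, fun _ => hp⟩
    have hp' : ¬ (edgeGraph E G).Reachable (E l).1 x' := fun h' => hn (hp.trans h')
    have hq' : (edgeGraph E G).Reachable (E l).2 x' := by
      by_contra hq'; exact k2 ⟨fun h' => absurd h' hp', fun h' => absurd h' hq'⟩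
    exact Or.inl ⟨hp, hq'⟩
  · have hq : (edgeGraph E G).Reachable x (E l).2 := by
      by_contra hq; exact k1 ⟨fun h' => absurd h' hp, fun h' => absurd h' hq⟩
    have hq' : ¬ (edgeGraph E G).Reachable (E l).2 x' := fun h' => hn (hq.trans h')
    have hp' : (edgeGraph E G).Reachable (E l).1 x' := by
      by_contra hp'; exact k2 ⟨fun h' => absurd h' hp', fun h' => absurd h' hq'⟩
    exact Or.inr ⟨hq, hp'⟩

/-- **Restricting to a component**: `a ~_G b` already holds using only the lines of `G` whose first endpoint lies in the `G`-component of
`a`. [cite: Biggs1974, Ch. 4 Prop. 4.3 (proof)] -/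
theorem reachable_filter_comp {G : Finset (Fin N)} {a b : Fin (V + 1)} (h : (edgeGraph E G).Reachable a b) :
    (edgeGraph E (G.filter fun e => (edgeGraph E G).Reachable a (E e).1)).Reachable a b := by
  classical
  set G' := G.filter fun e => (edgeGraph E G).Reachable a (E e).1 with hG'
  have hsub : G' ⊆ G := Finset.filter_subset _ _
  have hφ : ∀ e ∈ G, (edgeGraph E G').Reachable a (E e).1 = (edgeGraph E G').Reachable a (E e).2 := by
    intro e he
    have hpq : (edgeGraph E G).Reachable (E e).1 (E e).2 := SimpleGraph.ConnectedComponent.exact (connectedComponentMk_fst_eq E he)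
    apply propext
    constructor
    · intro h1
      have heG' : e ∈ G' := Finset.mem_filter.2 ⟨he, h1.mono (edgeGraph_mono hsub)⟩
      exact h1.trans (SimpleGraph.ConnectedComponent.exact (connectedComponentMk_fst_eq E heG'))
    · intro h2
      have ha1 : (edgeGraph E G).Reachable a (E e).1 := (h2.mono (edgeGraph_mono hsub)).trans hpq.symm
      have heG' : e ∈ G' := Finset.mem_filter.2 ⟨he, ha1⟩
      exact h2.trans (SimpleGraph.ConnectedComponent.exact (connectedComponentMk_fst_eq E heG')).symm
  have := apply_eq_of_reachable (fun v => (edgeGraph E G').Reachable a v) hφ h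
  exact this ▸ SimpleGraph.Reachable.refl a

end WordTools

/-! ### Weights along an arbitrary real ray `y`; optimal trees; the squared monomials -/

section WordWeights

variable {lep : Fin V → Fin N}

/-- `⟨χ_T, y⟩ = Σ_{e ∉ T} y_e` — the weight of the chord monomial of `T` along `y`. [cite: Volkov2016, §5.1 (19)–(20) with App. A (p.1185)] -/
theorem linPair_castExp_compl (T : Finset (Fin N)) (y : Fin N → ℝ) :
    linPair (castExp (∑ e' ∈ Tᶜ, Finsupp.single e' (1 : ℕ))) y = ∑ e ∈ Tᶜ, y e := by
  classical
  simp only [linPair, castExp, finsuppSum_single_one_apply]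
  rw [← Finset.sum_filter_add_sum_filter_not Finset.univ (fun i => i ∈ Tᶜ),
    Finset.sum_eq_zero (s := Finset.univ.filter fun i => ¬ i ∈ Tᶜ) (fun i hi => by rw [Finset.mem_filter] at hi; simp [hi.2]),
    add_zero, Finset.filter_mem_eq_inter, Finset.univ_inter]
  exact Finset.sum_congr rfl fun i hi => by simp [hi]

/-- `⟨χ_T + 𝟙_l, y⟩ = Σ_{e ∉ T} y_e + y_l`. [cite: Volkov2016, §5.1 (19)–(20) with App. A (p.1185)] -/
theorem linPair_castExp_pair (T : Finset (Fin N)) (l : Fin N) (y : Fin N → ℝ) :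
    linPair (castExp (∑ e' ∈ Tᶜ, Finsupp.single e' (1 : ℕ) + Finsupp.single l 1)) y = ∑ e ∈ Tᶜ, y e + y l := by
  rw [linPair_castExp_add, linPair_castExp_compl, linPair_castExp_single]

/-- `ord_y(V) ≤ Σ_{e ∉ T} y_e` for every spanning 1-tree `T` (each `χ_T` is a monomial of `V`). [cite: Volkov2016, §5.1 p.1174 (V) with App. A] -/
theorem rayOrder_kirchhoff_le_sum_compl {T : Finset (Fin N)} (hT : IsSpanningTree E T) (y : Fin N → ℝ) :
    rayOrder (kirchhoffPolynomial ℝ E) y ≤ ∑ e ∈ Tᶜ, y e := by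
  have hne : kirchhoffPolynomial ℝ E ≠ 0 := ne_zero_iff.2 ⟨_, mem_support_iff.1 (sum_single_compl_mem_support E hT)⟩
  rw [rayOrder_eq_inf' hne, ← linPair_castExp_compl]
  exact Finset.inf'_le _ (sum_single_compl_mem_support E hT)

/-- An optimal 1-tree: `ord_y(V) = Σ_{e ∉ T₀} y_e` for some spanning `T₀` (the order is attained on a monomial of `V`).
[cite: Volkov2016, §5.1 p.1174 (V) with App. A (p.1185)] -/
theorem exists_isSpanningTree_sum_compl_eq (hconn : IsConnectedEdgeList E) (y : Fin N → ℝ) :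
    ∃ T₀ : Finset (Fin N), IsSpanningTree E T₀ ∧ ∑ e ∈ T₀ᶜ, y e = rayOrder (kirchhoffPolynomial ℝ E) y := by
  have hne : kirchhoffPolynomial ℝ E ≠ 0 := kirchhoffPolynomial_ne_zero E ℝ hconn
  obtain ⟨d, hd, hdeq⟩ := Finset.exists_mem_eq_inf' (support_nonempty.2 hne) fun p => linPair (castExp p) y
  obtain ⟨T, hT, rfl⟩ := exists_isSpanningTree_of_mem_support E hd
  refine ⟨T, hT, ?_⟩
  rw [rayOrder_eq_inf' hne, hdeq, linPair_castExp_compl]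

/-- Chord bookkeeping for an exchange `T ↦ (T ∖ i) ∪ {l}`: `Σ_{e ∉ T′} y_e = Σ_{e ∉ T} y_e − y_l + y_i`. [folklore] -/
private theorem sum_compl_insert_erase {T : Finset (Fin N)} {i l : Fin N} (hi : i ∈ T) (hl : l ∉ T) (y : Fin N → ℝ) :
    ∑ e ∈ (insert l (T.erase i))ᶜ, y e = ∑ e ∈ Tᶜ, y e - y l + y i := by
  classical
  have hil : l ≠ i := fun h => hl (h ▸ hi)
  have hset : (insert l (T.erase i))ᶜ = insert i (Tᶜ.erase l) := by
    ext e
    simp only [Finset.mem_compl, Finset.mem_insert, Finset.mem_erase]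
    constructor
    · intro h
      by_cases hei : e = i
      · exact Or.inl hei
      · exact Or.inr ⟨fun hel => h (Or.inl hel), fun heT => h (Or.inr ⟨hei, heT⟩)⟩
    · rintro (hei | ⟨hel, heT⟩) h
      · rcases h with hel | ⟨hne, -⟩
        · exact hil (hel.symm.trans hei)
        · exact hne hei
      · rcases h with hel' | ⟨-, heT'⟩
        · exact hel hel'
        · exact heT heT'
  rw [hset, Finset.sum_insert (fun h => (Finset.mem_erase.1 h).2 |> Finset.mem_compl.1 |> fun h' => h' hi),
    Finset.sum_erase_eq_sub (Finset.mem_compl.2 hl)]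
  ring

/-- **A squared monomial is a monomial of `V·z_e − S`** (the pair `(T; l)` with `l` a chord of `T`; `S` is square-free).
[cite: Volkov2016, §5.2 p.1176 (PDF p.13 L91–L95)] -/
theorem pair_mem_support {u w : Fin (V + 1)} {P T : Finset (Fin N)} (hT : IsSpanningTree E T) {l : Fin N} (hlP : l ∈ P) (hlT : l ∉ T) :
    ∑ e' ∈ Tᶜ, Finsupp.single e' (1 : ℕ) + Finsupp.single l 1 ∈
      (kirchhoffPolynomial ℝ E * lineSum ℝ P - twoTreePolynomial ℝ E u w).support := by
  classical
  rw [mem_support_iff, coeff_sub, coeff_twoTreePolynomial_eq_zero_of_two_le ℝ u w (l := l)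
    (by rw [compl_add_single_apply_of_not_mem hlT]), sub_zero, coeff_kirchhoff_mul_lineSum, Nat.cast_ne_zero]
  exact (card_filter_pairs_pos hT hlP).ne'

end WordWeights

/-! ### The lower bound on the squared monomials and the upper bound (UB) -/

section WordBounds

variable {lep : Fin V → Fin N}

/-- **The bridge photon of a lepton chord**: if the lepton line `lep k` is a chord of the spanning tree `T`, some line `i ∈ T` lying OVER `k`
separates `k` from `k + 1` in `T ∖ i` (so `(T ∖ i) ∪ {lep k}` is again a spanning tree). Proof: otherwise `k ~ k+1` would survive the
deletion of ALL lines of `T` over `k` (exchange core), but the remaining lines cannot cross the gap (gap lemma).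
[cite: Volkov2020, §3.2 Lemma 3.4 (proof: «the graph that is obtained from G by removing all photon lines except i»); Biggs1974, Ch. 5 Prop. 5.4] -/
theorem exists_over_separating {T : Finset (Fin N)} (hT : IsSpanningTree E T) (k : Fin V) :
    (edgeGraph E T).Reachable (Fin.castSucc k) (Fin.succ k) →
    ∃ i ∈ T, Over E i k ∧ ¬ (edgeGraph E (T.erase i)).Reachable (Fin.castSucc k) (Fin.succ k) := by
  classical
  intro hreach
  by_contra H
  push Not at H
  set O := T.filter fun i => Over E i k with hO
  have hind : edgeRank E T = T.card := hT.2.trans hT.1.symm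
  have h1 : (edgeGraph E (T \ O)).Reachable (Fin.castSucc k) (Fin.succ k) :=
    reachable_sdiff_of_forall_erase hind (Finset.filter_subset _ _) hreach fun i hi =>
      H i (Finset.mem_filter.1 hi).1 (Finset.mem_filter.1 hi).2
  have h2 : ∀ e ∈ T \ O, ¬ Over E e k := fun e he hek =>
    (Finset.mem_sdiff.1 he).2 (Finset.mem_filter.2 ⟨(Finset.mem_sdiff.1 he).1, hek⟩)
  have h3 := le_iff_le_of_reachable h2 h1
  simp only [Fin.val_castSucc, Fin.val_succ, le_refl, true_iff] at h3
  omega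

/-- A line over `k` has distinct endpoints and is not a lepton line other than `lep k`. Plumbing. [cite: Volkov2020, §2.1] -/
theorem mem_photons_of_over (hlep : ∀ k, E (lep k) = (Fin.castSucc k, Fin.succ k)) {i : Fin N} {k : Fin V} (hik : Over E i k)
    (hne : i ≠ lep k) : i ∈ photons E lep := by
  unfold photons
  refine Finset.mem_filter.2 ⟨Finset.mem_univ _, fun h => ?_, fun h => ?_⟩
  · obtain ⟨j, -, rfl⟩ := Finset.mem_image.1 h
    exact hne (by rw [(over_lep_iff hlep j k).1 hik])
  · unfold Over at hik
    rw [h, min_self, max_self] at hik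
    omega

/-- **Lower bound on the squared monomials**: for a spanning 1-tree `T` with the lepton line `lep k` a chord, the monomial `X^{χ_T + 𝟙_{lep k}}`
has weight `≥ ord_y(V) + max(y_l, 2y_l − y_i)` for some photon `i` over `k` (`l = lep k`): with the bridge photon `i`, `(T ∖ i) ∪ {l}` is a
spanning tree, so `Σ_{e∉T} y_e − y_l + y_i ≥ ord_y(V)`. [cite: Volkov2020, §3.2 Lemma 3.4 with footnote 23; Volkov2016, §5.2 p.1176–1177] -/
theorem exists_photon_le_weight_pair (hlep : ∀ k, E (lep k) = (Fin.castSucc k, Fin.succ k)) {T : Finset (Fin N)}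
    (hT : IsSpanningTree E T) {k : Fin V} (hk : lep k ∉ T) (y : Fin N → ℝ) :
    ∃ i ∈ photons E lep, Over E i k ∧
      rayOrder (kirchhoffPolynomial ℝ E) y + max (y (lep k)) (2 * y (lep k) - y i) ≤ ∑ e ∈ Tᶜ, y e + y (lep k) := by
  classical
  have hreach : (edgeGraph E T).Reachable (Fin.castSucc k) (Fin.succ k) := hT.connected_edgeGraph.preconnected _ _
  obtain ⟨i, hiT, hik, hsep⟩ := exists_over_separating hT k hreach
  have hne : i ≠ lep k := fun h => hk (h ▸ hiT)
  refine ⟨i, mem_photons_of_over hlep hik hne, hik, ?_⟩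
  have hF2 : IsTwoTree E (T.erase i) := hT.isTwoTree_erase hiT
  have hT' : IsSpanningTree E (insert (lep k) (T.erase i)) := by
    refine (hF2.isSpanningTree_insert_iff (lep k)).2 ⟨fun h => hk (Finset.mem_of_mem_erase h), ?_⟩
    rw [hlep]
    exact hsep
  have h1 := rayOrder_kirchhoff_le_sum_compl hT' y
  rw [sum_compl_insert_erase hiT hk] at h1
  have h2 := rayOrder_kirchhoff_le_sum_compl hT y
  rw [← max_add_add_left, max_le_iff]
  constructor <;> linarith

/-- **Prefix cut**: if `lep k` is the ONLY lepton line joining the two components of the 2-tree `F`, then `0, …, k` lie on one side and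
`k+1, …, V` on the other, so every line over `k` joins the two components. [cite: Volkov2020, §3.2 Lemma 3.4 (proof: Z_i, the circuit with all photons but i removed); Volkov2016, §5.2 p.1176] -/
theorem not_reachable_of_over_of_prefixCut {F : Finset (Fin N)} {k : Fin V}
    (hcut : ¬ (edgeGraph E F).Reachable (Fin.castSucc k) (Fin.succ k))
    (honly : ∀ j : Fin V, j ≠ k → (edgeGraph E F).Reachable (Fin.castSucc j) (Fin.succ j)) {e : Fin N} (he : Over E e k) :
    ¬ (edgeGraph E F).Reachable (E e).1 (E e).2 := by
  -- every vertex `≤ k` is joined to `k`, every vertex `≥ k+1` to `k+1`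
  have hlow : ∀ m : Fin (V + 1), (m : ℕ) ≤ k → (edgeGraph E F).Reachable m (Fin.castSucc k) := by
    intro m hm
    refine reachable_of_chain (Fin.le_def.2 (by simpa using hm)) fun j hj1 hj2 => honly j ?_
    intro hjk; subst hjk; simp at hj2
  have hhigh : ∀ m : Fin (V + 1), (k : ℕ) + 1 ≤ m → (edgeGraph E F).Reachable (Fin.succ k) m := by
    intro m hm
    refine reachable_of_chain (Fin.le_def.2 (by simpa using hm)) fun j hj1 hj2 => honly j ?_
    intro hjk; subst hjk; simp at hj1
  intro hreach
  unfold Over at he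
  obtain ⟨h1, h2⟩ := he
  rcases le_total ((E e).1 : ℕ) ((E e).2 : ℕ) with hle | hle
  · rw [min_eq_left hle, max_eq_right hle] at *
    exact hcut ((hlow _ h1).symm.trans (hreach.trans (hhigh _ h2).symm))
  · rw [min_eq_right hle, max_eq_left hle] at *
    exact hcut ((hlow _ h1).symm.trans (hreach.symm.trans (hhigh _ h2).symm))

open scoped Classical in
/-- If the 2-tree monomial `χ_F`, `F = T₀ ∖ lep k`, is NOT a monomial of `V·z_e − S`, then `lep k` is the only lepton line crossing `F`
(its coefficient `#crossing − [sep]` vanishes and is `≥ 1 − 1`). [cite: Volkov2016, §5.2 p.1176 (PDF p.13 L96–L108)] -/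
theorem only_crossing_of_not_mem_support (hlep : ∀ k, E (lep k) = (Fin.castSucc k, Fin.succ k)) (hinj : Function.Injective lep)
    {u w : Fin (V + 1)} {T₀ : Finset (Fin N)} (hT₀ : IsSpanningTree E T₀) {k : Fin V} (hk : lep k ∈ T₀)
    (hns : ∑ e' ∈ (T₀.erase (lep k))ᶜ, Finsupp.single e' (1 : ℕ) ∉
      (kirchhoffPolynomial ℝ E * lineSum ℝ (Finset.univ.image lep) - twoTreePolynomial ℝ E u w).support) :
    ∀ j : Fin V, j ≠ k → (edgeGraph E (T₀.erase (lep k))).Reachable (Fin.castSucc j) (Fin.succ j) := by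
  set F := T₀.erase (lep k) with hF
  have hF2 : IsTwoTree E F := hT₀.isTwoTree_erase hk
  have hcross : ¬ (edgeGraph E F).Reachable (Fin.castSucc k) (Fin.succ k) := by
    have := ((hF2.isSpanningTree_insert_iff (lep k)).1 (by rw [hF, Finset.insert_erase hk]; exact hT₀)).2
    rwa [hlep] at this
  rw [mem_support_iff, not_not, coeff_kirchhoff_mul_lineSum_sub_twoTree ℝ u w hF2] at hns
  set C := (Finset.univ.image lep).filter fun l => ¬ (edgeGraph E F).Reachable (E l).1 (E l).2 with hC
  have hkC : lep k ∈ C := Finset.mem_filter.2 ⟨Finset.mem_image_of_mem _ (Finset.mem_univ k), by rw [hlep]; exact hcross⟩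
  have hC1 : C.card = 1 := by
    have hpos : 1 ≤ C.card := Finset.card_pos.2 ⟨_, hkC⟩
    split_ifs at hns with hsep
    · have : (C.card : ℝ) = 1 := by linarith
      exact_mod_cast this
    · have : (C.card : ℝ) = 0 := by linarith
      have h0 : C.card = 0 := by exact_mod_cast this
      omega
  obtain ⟨l₀, hl₀⟩ := Finset.card_eq_one.1 hC1
  have hkl₀ : lep k = l₀ := by rw [hl₀] at hkC; exact Finset.mem_singleton.1 hkC
  intro j hjk
  by_contra hj
  have hjC : lep j ∈ C := Finset.mem_filter.2 ⟨Finset.mem_image_of_mem _ (Finset.mem_univ j), by rw [hlep]; exact hj⟩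
  rw [hl₀, Finset.mem_singleton, ← hkl₀] at hjC
  exact hjk (hinj hjC)

open scoped Classical in
/-- **(UB) For every photon `i` and every lepton line `l = lep k` under it there is a monomial of `V·z_e − S` of weight
`≤ ord_y(V) + max(y_l, 2y_l − y_i)`**: with an optimal tree `T₀` — if `l ∉ T₀` the squared pair `(T₀; l)`; if `l ∈ T₀` and `χ_{T₀∖l}`
survives, that 2-tree monomial; otherwise `T₀ ∖ l` is the prefix cut at `l`, `i` crosses it, and the squared pair `((T₀ ∖ l) ∪ {i}; l)` has
weight `ord_y(V) + 2y_l − y_i` (the combinatorial shadow of «Z ≤ Z_i ≤ Z₀ … |W| ≥ m²(Z₀ − Z_i)» in the proof of Lemma 3.4).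
[cite: Volkov2020, §3.2 Lemma 3.4 (3.3) and its proof; Volkov2016, §5.2 p.1176–1177] -/
theorem exists_mem_support_weight_le (hlep : ∀ k, E (lep k) = (Fin.castSucc k, Fin.succ k)) (hinj : Function.Injective lep)
    (hconn : IsConnectedEdgeList E) (u w : Fin (V + 1)) (y : Fin N → ℝ) {i : Fin N} (hi : i ∈ photons E lep) {k : Fin V}
    (hik : Over E i k) :
    ∃ d ∈ (kirchhoffPolynomial ℝ E * lineSum ℝ (Finset.univ.image lep) - twoTreePolynomial ℝ E u w).support,
      linPair (castExp d) y ≤ rayOrder (kirchhoffPolynomial ℝ E) y + max (y (lep k)) (2 * y (lep k) - y i) := by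
  obtain ⟨T₀, hT₀, hM⟩ := exists_isSpanningTree_sum_compl_eq hconn y
  have hlP : lep k ∈ Finset.univ.image lep := Finset.mem_image_of_mem _ (Finset.mem_univ k)
  have hil : i ≠ lep k := by
    intro h
    unfold photons at hi
    exact (Finset.mem_filter.1 hi).2.1 (h ▸ hlP)
  by_cases hk : lep k ∈ T₀
  · set F := T₀.erase (lep k) with hF
    by_cases hs : ∑ e' ∈ Fᶜ, Finsupp.single e' (1 : ℕ) ∈
        (kirchhoffPolynomial ℝ E * lineSum ℝ (Finset.univ.image lep) - twoTreePolynomial ℝ E u w).support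
    · refine ⟨_, hs, ?_⟩
      rw [linPair_castExp_compl, hF, Finset.compl_erase, Finset.sum_insert (Finset.mem_compl.1.mt (not_not.2 hk)), hM]
      have := le_max_left (y (lep k)) (2 * y (lep k) - y i)
      linarith
    · -- prefix cut: `i` crosses `F`
      have honly := only_crossing_of_not_mem_support hlep hinj hT₀ hk hs
      have hF2 : IsTwoTree E F := hT₀.isTwoTree_erase hk
      have hcut : ¬ (edgeGraph E F).Reachable (Fin.castSucc k) (Fin.succ k) := by
        have := ((hF2.isSpanningTree_insert_iff (lep k)).1 (by rw [hF, Finset.insert_erase hk]; exact hT₀)).2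
        rwa [hlep] at this
      have hicross := not_reachable_of_over_of_prefixCut hcut honly hik
      have hiF : i ∉ F := fun h => hicross (SimpleGraph.ConnectedComponent.exact (connectedComponentMk_fst_eq E h))
      have hT : IsSpanningTree E (insert i F) := (hF2.isSpanningTree_insert_iff i).2 ⟨hiF, hicross⟩
      have hlT : lep k ∉ insert i F := by
        rw [Finset.mem_insert, hF, Finset.mem_erase]; push Not
        exact ⟨hil.symm, fun h => absurd rfl h⟩
      refine ⟨_, pair_mem_support hT hlP hlT, ?_⟩
      have hiT₀ : i ∉ T₀ := fun h => hiF (Finset.mem_erase.2 ⟨hil, h⟩)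
      rw [linPair_castExp_pair, hF, sum_compl_insert_erase hk hiT₀, hM]
      have := le_max_right (y (lep k)) (2 * y (lep k) - y i)
      linarith
  · refine ⟨_, pair_mem_support hT₀ hlP hk, ?_⟩
    rw [linPair_castExp_pair, hM]
    have := le_max_left (y (lep k)) (2 * y (lep k) - y i)
    linarith

end WordBounds

/-! ### The lower bound on the 2-tree monomials (a run of the far component, a jumping photon, one exchange) -/

section WordTwoTree

variable {lep : Fin V → Fin N}

open scoped Classical in
/-- **Two consecutive crossings.** If the 2-tree monomial `χ_F` occurs in `V·z_e − S` (coefficient `#crossing lepton lines − [F separates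
0 from V] ≥ 1`), then there are lepton lines `lep k₁`, `lep k₂`, `k₁ < k₂`, both joining the two components of `F`, with no crossing
strictly between them and none before `k₁`. [cite: Volkov2016, §5.2 p.1176 (PDF p.13 L96–L108); Volkov2020, §2.1 (the lepton path)] -/
theorem exists_two_crossings (hlep : ∀ k, E (lep k) = (Fin.castSucc k, Fin.succ k)) (hinj : Function.Injective lep)
    {F : Finset (Fin N)} (hF : IsTwoTree E F)
    (hs : ∑ e' ∈ Fᶜ, Finsupp.single e' (1 : ℕ) ∈
      (kirchhoffPolynomial ℝ E * lineSum ℝ (Finset.univ.image lep) - twoTreePolynomial ℝ E 0 (Fin.last V)).support) :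
    ∃ k₁ k₂ : Fin V, k₁ < k₂ ∧ ¬ (edgeGraph E F).Reachable (Fin.castSucc k₁) (Fin.succ k₁) ∧
      ¬ (edgeGraph E F).Reachable (Fin.castSucc k₂) (Fin.succ k₂) ∧
      (∀ j : Fin V, j < k₁ → (edgeGraph E F).Reachable (Fin.castSucc j) (Fin.succ j)) ∧
      (∀ j : Fin V, k₁ < j → j < k₂ → (edgeGraph E F).Reachable (Fin.castSucc j) (Fin.succ j)) := by
  set K := Finset.univ.filter fun j : Fin V => ¬ (edgeGraph E F).Reachable (Fin.castSucc j) (Fin.succ j) with hK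
  set C := (Finset.univ.image lep).filter fun l => ¬ (edgeGraph E F).Reachable (E l).1 (E l).2 with hC
  have hCK : C = K.image lep := by
    ext l
    simp only [hC, hK, Finset.mem_filter, Finset.mem_image, Finset.mem_univ, true_and]
    constructor
    · rintro ⟨⟨j, rfl⟩, hl⟩
      exact ⟨j, by rw [hlep] at hl; exact hl, rfl⟩
    · rintro ⟨j, hj, rfl⟩
      exact ⟨⟨j, rfl⟩, by rw [hlep]; exact hj⟩
  have hcardCK : C.card = K.card := by rw [hCK, Finset.card_image_of_injective _ hinj]
  rw [mem_support_iff, coeff_kirchhoff_mul_lineSum_sub_twoTree ℝ 0 (Fin.last V) hF, ← hC, hcardCK] at hs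
  -- chain: if no index in an interval crosses, its ends are joined
  have hmemK : ∀ j : Fin V, j ∈ K ↔ ¬ (edgeGraph E F).Reachable (Fin.castSucc j) (Fin.succ j) := fun j => by
    simp [hK]
  -- K is non-empty
  have hKne : K.Nonempty := by
    rw [Finset.nonempty_iff_ne_empty]
    intro hK0
    have hall : ∀ j : Fin V, (edgeGraph E F).Reachable (Fin.castSucc j) (Fin.succ j) := fun j => by
      by_contra h; have := (hmemK j).2 h; rw [hK0] at this; exact Finset.notMem_empty j this
    have h0V : (edgeGraph E F).Reachable (0 : Fin (V + 1)) (Fin.last V) :=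
      reachable_of_chain (Fin.zero_le _) fun j _ _ => hall j
    have hnsep : ¬ IsSepTwoTree E 0 (Fin.last V) F := fun h => h.2 h0V
    rw [hK0, Finset.card_empty, if_neg hnsep] at hs
    simp at hs
  set k₁ := K.min' hKne with hk₁
  have hk₁K : k₁ ∈ K := Finset.min'_mem K hKne
  have hbelow : ∀ j : Fin V, j < k₁ → (edgeGraph E F).Reachable (Fin.castSucc j) (Fin.succ j) := by
    intro j hj
    by_contra h
    exact absurd (Finset.min'_le K j ((hmemK j).2 h)) (not_le.2 (hk₁ ▸ hj))
  -- a second crossing above k₁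
  have hexists : ∃ k ∈ K, k₁ < k := by
    by_contra hno
    push Not at hno
    have hK1 : ∀ j : Fin V, j ≠ k₁ → (edgeGraph E F).Reachable (Fin.castSucc j) (Fin.succ j) := by
      intro j hj
      by_contra h
      have hjK := (hmemK j).2 h
      exact hj (le_antisymm (hno j hjK) (Finset.min'_le K j hjK))
    by_cases hsep : IsSepTwoTree E 0 (Fin.last V) F
    · -- separating: the coefficient is `|K| − 1 ≠ 0`, so `|K| ≥ 2`
      rw [if_pos hsep] at hs
      have hcard : K.card ≠ 1 := fun h => hs (by rw [h]; norm_num)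
      have hK1' : K = {k₁} := Finset.eq_singleton_iff_unique_mem.2 ⟨hk₁K, fun j hj => by
        by_contra hne; exact (hmemK j).1 hj (hK1 j hne)⟩
      exact hcard (by rw [hK1', Finset.card_singleton])
    · -- not separating: `0 ~ V`, but the only crossing `k₁` disconnects the path
      have h0V : (edgeGraph E F).Reachable (0 : Fin (V + 1)) (Fin.last V) := by
        by_contra h; exact hsep ⟨hF, h⟩
      have h0k : (edgeGraph E F).Reachable (0 : Fin (V + 1)) (Fin.castSucc k₁) :=
        reachable_of_chain (Fin.zero_le _) fun j _ hj2 => hK1 j (by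
          intro hjk; subst hjk; simp at hj2)
      have hkV : (edgeGraph E F).Reachable (Fin.succ k₁) (Fin.last V) :=
        reachable_of_chain (Fin.le_last _) fun j hj1 _ => hK1 j (by
          intro hjk; subst hjk; simp at hj1)
      exact (hmemK k₁).1 hk₁K (h0k.symm.trans (h0V.trans hkV.symm))
  obtain ⟨k, hkK, hk₁k⟩ := hexists
  set K' := K.filter fun j => k₁ < j with hK'
  have hK'ne : K'.Nonempty := ⟨k, Finset.mem_filter.2 ⟨hkK, hk₁k⟩⟩
  set k₂ := K'.min' hK'ne with hk₂
  have hk₂K' : k₂ ∈ K' := Finset.min'_mem K' hK'ne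
  refine ⟨k₁, k₂, (Finset.mem_filter.1 hk₂K').2, (hmemK k₁).1 hk₁K, (hmemK k₂).1 (Finset.mem_filter.1 hk₂K').1, hbelow, ?_⟩
  intro j hj1 hj2
  by_contra h
  have hjK' : j ∈ K' := Finset.mem_filter.2 ⟨(hmemK j).2 h, hj1⟩
  exact absurd (Finset.min'_le K' j hjK') (not_le.2 (hk₂ ▸ hj2))

/-- **A jumping line of the near component.** In the situation of `exists_two_crossings` — the run `k₁+1, …, k₂` of the far component —
some line `j ∈ F` has one endpoint `≤ k₁` and the other `≥ k₂ + 1` AND separates `k₁` from `k₂ + 1` in `F ∖ j` (exchange core + the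
indicator of `{v ≤ k₁}`, which no other line of `F` can change). [cite: Volkov2020, §3.2 Lemma 3.4 (proof) with footnote 23; Biggs1974, Ch. 5 Prop. 5.4] -/
theorem exists_jump {F : Finset (Fin N)} (hF : IsTwoTree E F) {k₁ k₂ : Fin V} (hlt : k₁ < k₂)
    (hc₁ : ¬ (edgeGraph E F).Reachable (Fin.castSucc k₁) (Fin.succ k₁))
    (hc₂ : ¬ (edgeGraph E F).Reachable (Fin.castSucc k₂) (Fin.succ k₂))
    (hbelow : ∀ j : Fin V, j < k₁ → (edgeGraph E F).Reachable (Fin.castSucc j) (Fin.succ j))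
    (hbetween : ∀ j : Fin V, k₁ < j → j < k₂ → (edgeGraph E F).Reachable (Fin.castSucc j) (Fin.succ j)) :
    ∃ j ∈ F, min ((E j).1 : ℕ) ((E j).2 : ℕ) ≤ k₁ ∧ (k₂ : ℕ) + 1 ≤ max ((E j).1 : ℕ) ((E j).2 : ℕ) ∧
      ¬ (edgeGraph E (F.erase j)).Reachable (Fin.castSucc k₁) (Fin.succ k₂) := by
  classical
  have hF' : IsSpanningTwoForest E F := (isTwoTree_iff_isSpanningTwoForest F).1 hF
  have hind : edgeRank E F = F.card := hF'.2
  -- sides: X = component of `k₁`, Y = component of `k₁ + 1`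
  have hside : ∀ v, (edgeGraph E F).Reachable (Fin.castSucc k₁) v ↔ ¬ (edgeGraph E F).Reachable (Fin.succ k₁) v :=
    hF'.reachable_iff_not_reachable hc₁
  have hXlow : ∀ v : Fin (V + 1), (v : ℕ) ≤ k₁ → (edgeGraph E F).Reachable (Fin.castSucc k₁) v := by
    intro v hv
    refine (reachable_of_chain (Fin.le_def.2 (by simpa using hv)) fun j hj1 hj2 => hbelow j ?_).symm
    exact Fin.lt_def.2 (by simpa using hj2)
  have hYrun : ∀ v : Fin (V + 1), (k₁ : ℕ) + 1 ≤ v → (v : ℕ) ≤ k₂ → (edgeGraph E F).Reachable (Fin.succ k₁) v := by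
    intro v hv1 hv2
    refine reachable_of_chain (Fin.le_def.2 (by simpa using hv1)) fun j hj1 hj2 => hbetween j ?_ ?_
    · exact Fin.lt_def.2 (by simp at hj1; omega)
    · exact Fin.lt_def.2 (by omega)
  have hXhigh : (edgeGraph E F).Reachable (Fin.castSucc k₁) (Fin.succ k₂) := by
    rw [hside]
    intro h
    have hb : (edgeGraph E F).Reachable (Fin.succ k₁) (Fin.castSucc k₂) :=
      hYrun _ (by simp; omega) (by simp)
    exact hc₂ (hb.symm.trans h)
  -- the jumping lines
  set O := F.filter fun e => min ((E e).1 : ℕ) ((E e).2 : ℕ) ≤ k₁ ∧ (k₂ : ℕ) + 1 ≤ max ((E e).1 : ℕ) ((E e).2 : ℕ) with hO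
  by_contra H
  push Not at H
  have hall : ∀ e ∈ O, (edgeGraph E (F.erase e)).Reachable (Fin.castSucc k₁) (Fin.succ k₂) := fun e he =>
    H e (Finset.mem_filter.1 he).1 (Finset.mem_filter.1 he).2.1 (Finset.mem_filter.1 he).2.2
  have hrest := reachable_sdiff_of_forall_erase hind (Finset.filter_subset _ _) hXhigh hall
  -- the indicator of `{v ≤ k₁}` is constant along the lines of `F ∖ O`
  have hconst : ∀ e ∈ F \ O, (((E e).1 : ℕ) ≤ k₁ : Prop) = (((E e).2 : ℕ) ≤ k₁ : Prop) := by
    intro e he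
    obtain ⟨heF, heO⟩ := Finset.mem_sdiff.1 he
    have hpq : (edgeGraph E F).Reachable (E e).1 (E e).2 := SimpleGraph.ConnectedComponent.exact (connectedComponentMk_fst_eq E heF)
    apply propext
    by_cases hY : (edgeGraph E F).Reachable (Fin.succ k₁) (E e).1
    · -- both endpoints on the far side, hence `> k₁`
      have hY2 : (edgeGraph E F).Reachable (Fin.succ k₁) (E e).2 := hY.trans hpq
      have n1 : ¬ ((E e).1 : ℕ) ≤ k₁ := fun h => (hside _).1 (hXlow _ h) hY
      have n2 : ¬ ((E e).2 : ℕ) ≤ k₁ := fun h => (hside _).1 (hXlow _ h) hY2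
      exact ⟨fun h => absurd h n1, fun h => absurd h n2⟩
    · -- both endpoints on the near side, hence outside the run; not jumping ⇒ same side of the run
      have hX1 : (edgeGraph E F).Reachable (Fin.castSucc k₁) (E e).1 := (hside _).2 hY
      have hX2 : (edgeGraph E F).Reachable (Fin.castSucc k₁) (E e).2 := hX1.trans hpq
      have out1 : ((E e).1 : ℕ) ≤ k₁ ∨ (k₂ : ℕ) + 1 ≤ (E e).1 := by
        by_contra h; push Not at h
        exact (hside _).1 hX1 (hYrun _ (by omega) (by omega))
      have out2 : ((E e).2 : ℕ) ≤ k₁ ∨ (k₂ : ℕ) + 1 ≤ (E e).2 := by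
        by_contra h; push Not at h
        exact (hside _).1 hX2 (hYrun _ (by omega) (by omega))
      have hnj : ¬ (min ((E e).1 : ℕ) ((E e).2 : ℕ) ≤ k₁ ∧ (k₂ : ℕ) + 1 ≤ max ((E e).1 : ℕ) ((E e).2 : ℕ)) :=
        fun h => heO (Finset.mem_filter.2 ⟨heF, h⟩)
      have hlt' : (k₁ : ℕ) < k₂ := Fin.lt_def.1 hlt
      constructor
      · intro h1
        rcases out2 with h2 | h2
        · exact h2
        · exact absurd ⟨(min_le_left _ _).trans h1, h2.trans (le_max_right _ _)⟩ hnj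
      · intro h2
        rcases out1 with h1 | h1
        · exact h1
        · exact absurd ⟨(min_le_right _ _).trans h2, h1.trans (le_max_left _ _)⟩ hnj
  have := apply_eq_of_reachable (fun v : Fin (V + 1) => ((v : ℕ) ≤ k₁ : Prop)) hconst hrest
  simp only [Fin.val_castSucc, le_refl, Fin.val_succ, eq_iff_iff, true_iff] at this
  have hlt' : (k₁ : ℕ) < k₂ := Fin.lt_def.1 hlt
  omega

/-- **Lower bound on the 2-tree monomials**: if `χ_F` is a monomial of `V·z_e − S` then for some photon `j` and lepton lines `lep k₁`,
`lep k₂` under it, `Σ_{e∉F} y_e ≥ ord_y(V) + y_{k₁}` and `Σ_{e∉F} y_e ≥ ord_y(V) + y_{k₁} + y_{k₂} − y_j` (the trees `F + lep k₁` and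
`F + lep k₁ + lep k₂ − j`). [cite: Volkov2020, §3.2 Lemma 3.4 with footnote 23; Volkov2016, §5.2 p.1176–1177] -/
theorem exists_photon_le_weight_twoTree (hlep : ∀ k, E (lep k) = (Fin.castSucc k, Fin.succ k)) (hinj : Function.Injective lep)
    {F : Finset (Fin N)} (hF : IsTwoTree E F)
    (hs : ∑ e' ∈ Fᶜ, Finsupp.single e' (1 : ℕ) ∈
      (kirchhoffPolynomial ℝ E * lineSum ℝ (Finset.univ.image lep) - twoTreePolynomial ℝ E 0 (Fin.last V)).support)
    (y : Fin N → ℝ) :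
    ∃ j ∈ photons E lep, ∃ k₁ k₂ : Fin V, Over E j k₁ ∧ Over E j k₂ ∧
      rayOrder (kirchhoffPolynomial ℝ E) y + y (lep k₁) ≤ ∑ e ∈ Fᶜ, y e ∧
      rayOrder (kirchhoffPolynomial ℝ E) y + (y (lep k₁) + y (lep k₂) - y j) ≤ ∑ e ∈ Fᶜ, y e := by
  classical
  obtain ⟨k₁, k₂, hlt, hc₁, hc₂, hbelow, hbetween⟩ := exists_two_crossings hlep hinj hF hs
  obtain ⟨j, hjF, hjlo, hjhi, hstar⟩ := exists_jump hF hlt hc₁ hc₂ hbelow hbetween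
  have hlt' : (k₁ : ℕ) < k₂ := Fin.lt_def.1 hlt
  have hjk₁ : Over E j k₁ := ⟨hjlo, by omega⟩
  have hjk₂ : Over E j k₂ := ⟨by omega, hjhi⟩
  -- `j` is a photon, distinct from the two lepton lines
  have hjl₁ : j ≠ lep k₁ := by
    intro h; rw [h] at hjk₂; exact absurd ((over_lep_iff hlep k₁ k₂).1 hjk₂) (ne_of_lt hlt)
  have hjl₂ : j ≠ lep k₂ := by
    intro h; rw [h] at hjk₁; exact absurd ((over_lep_iff hlep k₂ k₁).1 hjk₁) (ne_of_gt hlt)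
  have hjph : j ∈ photons E lep := mem_photons_of_over hlep hjk₁ hjl₁
  refine ⟨j, hjph, k₁, k₂, hjk₁, hjk₂, ?_, ?_⟩
  · -- the tree `F + lep k₁`
    have hl₁F : lep k₁ ∉ F := fun h => hc₁ (by
      have := SimpleGraph.ConnectedComponent.exact (connectedComponentMk_fst_eq E h); rwa [hlep] at this)
    have hT₁ : IsSpanningTree E (insert (lep k₁) F) := (hF.isSpanningTree_insert_iff _).2 ⟨hl₁F, by rw [hlep]; exact hc₁⟩
    have h := rayOrder_kirchhoff_le_sum_compl hT₁ y
    rw [Finset.compl_insert, Finset.sum_erase_eq_sub (Finset.mem_compl.2 hl₁F)] at h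
    linarith
  · -- the tree `F + lep k₁ + lep k₂ − j`
    have hl₁F : lep k₁ ∉ F := fun h => hc₁ (by
      have := SimpleGraph.ConnectedComponent.exact (connectedComponentMk_fst_eq E h); rwa [hlep] at this)
    have hl₂F : lep k₂ ∉ F := fun h => hc₂ (by
      have := SimpleGraph.ConnectedComponent.exact (connectedComponentMk_fst_eq E h); rwa [hlep] at this)
    have hl₁₂ : lep k₂ ≠ lep k₁ := fun h => (ne_of_gt hlt) (hinj h)
    have hT₁ : IsSpanningTree E (insert (lep k₁) F) := (hF.isSpanningTree_insert_iff _).2 ⟨hl₁F, by rw [hlep]; exact hc₁⟩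
    have hjT₁ : j ∈ insert (lep k₁) F := Finset.mem_insert_of_mem hjF
    have hF₁ : IsTwoTree E ((insert (lep k₁) F).erase j) := hT₁.isTwoTree_erase hjT₁
    have herase : (insert (lep k₁) F).erase j = insert (lep k₁) (F.erase j) := Finset.erase_insert_of_ne hjl₁.symm
    -- `lep k₂` still crosses after the exchange
    have hcross : ¬ (edgeGraph E ((insert (lep k₁) F).erase j)).Reachable (Fin.castSucc k₂) (Fin.succ k₂) := by
      rw [herase]
      intro h
      have hG : ¬ (edgeGraph E (F.erase j)).Reachable (Fin.castSucc k₂) (Fin.succ k₂) :=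
        fun h' => hc₂ (h'.mono (edgeGraph_mono (Finset.erase_subset j F)))
      rcases reachable_insert_cases h hG with ⟨h1, -⟩ | ⟨-, h2⟩
      · -- `k₂ ~ k₁` in `F ∖ j`: but `k₂` is on the far side
        rw [hlep] at h1
        have h1' : (edgeGraph E F).Reachable (Fin.castSucc k₂) (Fin.castSucc k₁) := h1.mono (edgeGraph_mono (Finset.erase_subset j F))
        have hY : (edgeGraph E F).Reachable (Fin.succ k₁) (Fin.castSucc k₂) :=
          reachable_of_chain (Fin.le_def.2 (by simp; omega)) fun i hi1 hi2 => hbetween i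
            (Fin.lt_def.2 (by simp at hi1; omega)) (Fin.lt_def.2 (by simpa using hi2))
        exact hc₁ (hY.trans h1').symm
      · rw [hlep] at h2
        exact hstar h2
    have hl₂T : lep k₂ ∉ (insert (lep k₁) F).erase j := by
      rw [herase, Finset.mem_insert, Finset.mem_erase]
      push Not
      exact ⟨hl₁₂, fun _ => hl₂F⟩
    have hT₂ : IsSpanningTree E (insert (lep k₂) ((insert (lep k₁) F).erase j)) :=
      (hF₁.isSpanningTree_insert_iff _).2 ⟨hl₂T, by rw [hlep]; exact hcross⟩
    have h := rayOrder_kirchhoff_le_sum_compl hT₂ y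
    have hl₂T₁ : lep k₂ ∉ insert (lep k₁) F := by
      rw [Finset.mem_insert]; push Not; exact ⟨hl₁₂, hl₂F⟩
    rw [sum_compl_insert_erase hjT₁ hl₂T₁, Finset.compl_insert, Finset.sum_erase_eq_sub (Finset.mem_compl.2 hl₁F)] at h
    linarith

end WordTwoTree

/-! ### Assembly: `ord_y(V·z_e − S) = ord_y(V) + min_{i, k : i over k} max(y_k, 2y_k − y_i)` -/

section WordValuation

variable {lep : Fin V → Fin N}

/-- The lepton path joins every pair of vertices; in particular a word is a connected edge list. [cite: Volkov2020, §2.1 (Lept(E(G)) is a path joining the external vertices)] -/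
theorem reachable_of_word (hlep : ∀ k, E (lep k) = (Fin.castSucc k, Fin.succ k)) {G : Finset (Fin N)}
    (hG : ∀ k, lep k ∈ G) {a b : Fin (V + 1)} (hab : a ≤ b) : (edgeGraph E G).Reachable a b :=
  reachable_of_chain hab fun k _ _ => by
    have := SimpleGraph.ConnectedComponent.exact (connectedComponentMk_fst_eq E (hG k))
    rwa [hlep] at this

/-- A word is a connected edge list. [cite: Volkov2020, §2.1] -/
theorem isConnectedEdgeList_of_word (hlep : ∀ k, E (lep k) = (Fin.castSucc k, Fin.succ k)) : IsConnectedEdgeList E := by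
  rw [isConnectedEdgeList_iff_connected, SimpleGraph.connected_iff]
  refine ⟨fun a b => ?_, ⟨0⟩⟩
  rcases le_total a b with h | h
  · exact reachable_of_word hlep (fun k => Finset.mem_univ _) h
  · exact (reachable_of_word hlep (fun k => Finset.mem_univ _) h).symm

/-- Every photon lies over some lepton line (its smaller endpoint). [cite: Volkov2020, §2.1 (LPath(i) is non-empty)] -/
theorem exists_over_of_mem_photons {i : Fin N} (hi : i ∈ photons E lep) : ∃ k : Fin V, Over E i k := by
  unfold photons at hi
  obtain ⟨-, -, hne⟩ := Finset.mem_filter.1 hi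
  have hne' : ((E i).1 : ℕ) ≠ (E i).2 := fun h => hne (Fin.ext h)
  have h1 := (E i).1.2
  have h2 := (E i).2.2
  set a : ℕ := ((E i).1 : ℕ) with ha
  set b : ℕ := ((E i).2 : ℕ) with hb
  have hlt : min a b + 1 ≤ max a b := by
    rcases le_total a b with h | h
    · rw [min_eq_left h, max_eq_right h]; omega
    · rw [min_eq_right h, max_eq_left h]; omega
  have hmV : min a b < V := by
    have : max a b ≤ V := by
      rcases le_total a b with h | h
      · rw [max_eq_right h]; omega
      · rw [max_eq_left h]; omega
    omega
  exact ⟨⟨min a b, hmV⟩, le_rfl, hlt⟩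

/-- The pairs (photon `i`, lepton index `k`) with `i` over `k` — the index set of the minimum in Lemma 3.4's valuation form
(`min_i min_{l ∈ LPath(i)}`). [cite: Volkov2020, §3.2 Lemma 3.4 (3.3) (max over i ∈ Ph, z′_i = max over LPath(i))] -/
def overPairs (E : Fin N → Fin (V + 1) × Fin (V + 1)) (lep : Fin V → Fin N) : Finset (Fin N × Fin V) :=
  ((photons E lep) ×ˢ (Finset.univ : Finset (Fin V))).filter fun p => Over E p.1 p.2

/-- Membership in `overPairs`. [cite: Volkov2020, §3.2 Lemma 3.4 (3.3)] -/
theorem mem_overPairs_iff (p : Fin N × Fin V) : p ∈ overPairs E lep ↔ p.1 ∈ photons E lep ∧ Over E p.1 p.2 := by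
  unfold overPairs
  rw [Finset.mem_filter, Finset.mem_product]
  simp

open scoped Classical in
/-- Every monomial of `V·z_e − S` is a monomial of `V·z_e` (for a word: the lepton path joins `0` to `V`, so every separating 2-tree is
crossed). Plumbing. [cite: Volkov2016, §5.2 p.1176 (PDF p.13 L96–L108)] -/
theorem coeff_kirchhoff_mul_lineSum_ne_zero_of_mem_support (hlep : ∀ k, E (lep k) = (Fin.castSucc k, Fin.succ k))
    {d : Fin N →₀ ℕ}
    (hd : d ∈ (kirchhoffPolynomial ℝ E * lineSum ℝ (Finset.univ.image lep) - twoTreePolynomial ℝ E 0 (Fin.last V)).support) :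
    coeff d (kirchhoffPolynomial ℝ E * lineSum ℝ (Finset.univ.image lep)) ≠ 0 := by
  intro h0
  rw [mem_support_iff, coeff_sub, h0, zero_sub, neg_ne_zero, coeff_twoTreePolynomial] at hd
  split_ifs at hd with hF
  · obtain ⟨F, hF, rfl⟩ := hF
    rw [coeff_kirchhoff_mul_lineSum_twoTree ℝ hF.1, Nat.cast_eq_zero] at h0
    have hP : (edgeGraph E (Finset.univ.image lep)).Reachable 0 (Fin.last V) :=
      reachable_of_word hlep (fun k => Finset.mem_image_of_mem _ (Finset.mem_univ k)) (Fin.zero_le _)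
    have h1 := one_le_card_filter_crossing_of_isSepTwoTree hF hP
    omega
  · exact hd rfl

/-- **(LB) Every monomial of `V·z_e − S` has weight `≥ ord_y(V) + max(y_k, 2y_k − y_i)` for SOME photon `i` over SOME lepton line `k`.**
[cite: Volkov2020, §3.2 Lemma 3.4 (3.3) with footnote 23; Volkov2016, §5.2 p.1176–1177] -/
theorem exists_pair_le_weight_of_mem_support (hlep : ∀ k, E (lep k) = (Fin.castSucc k, Fin.succ k))
    (hinj : Function.Injective lep) (y : Fin N → ℝ) {d : Fin N →₀ ℕ}
    (hd : d ∈ (kirchhoffPolynomial ℝ E * lineSum ℝ (Finset.univ.image lep) - twoTreePolynomial ℝ E 0 (Fin.last V)).support) :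
    ∃ i ∈ photons E lep, ∃ k : Fin V, Over E i k ∧
      rayOrder (kirchhoffPolynomial ℝ E) y + max (y (lep k)) (2 * y (lep k) - y i) ≤ linPair (castExp d) y := by
  classical
  obtain ⟨T, l, hT, hlP, rfl⟩ :=
    exists_pair_of_coeff_kirchhoff_mul_lineSum_ne_zero ℝ (coeff_kirchhoff_mul_lineSum_ne_zero_of_mem_support hlep hd)
  obtain ⟨k, -, rfl⟩ := Finset.mem_image.1 hlP
  rw [linPair_castExp_pair]
  by_cases hk : lep k ∈ T
  · -- a 2-tree monomial `χ_{T ∖ lep k}`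
    have hdF : ∑ e' ∈ Tᶜ, Finsupp.single e' (1 : ℕ) + Finsupp.single (lep k) 1 =
        ∑ e' ∈ (T.erase (lep k))ᶜ, Finsupp.single e' 1 :=
      (compl_add_single_eq_compl_iff T (T.erase (lep k)) (lep k)).2 ⟨Finset.notMem_erase _ _, (Finset.insert_erase hk).symm⟩
    rw [hdF] at hd
    obtain ⟨j, hj, k₁, k₂, hjk₁, hjk₂, h1, h2⟩ := exists_photon_le_weight_twoTree hlep hinj (hT.isTwoTree_erase hk) hd y
    have hW : ∑ e ∈ (T.erase (lep k))ᶜ, y e = ∑ e ∈ Tᶜ, y e + y (lep k) := by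
      rw [Finset.compl_erase, Finset.sum_insert (fun h => (Finset.mem_compl.1 h) hk)]; ring
    rw [hW] at h1 h2
    rcases le_total (y (lep k₁)) (y (lep k₂)) with h12 | h12
    · refine ⟨j, hj, k₁, hjk₁, ?_⟩
      rw [← max_add_add_left, max_le_iff]; constructor <;> linarith
    · refine ⟨j, hj, k₂, hjk₂, ?_⟩
      rw [← max_add_add_left, max_le_iff]; constructor <;> linarith
  · -- a squared monomial
    obtain ⟨i, hi, hik, h⟩ := exists_photon_le_weight_pair hlep hT hk y
    exact ⟨i, hi, k, hik, h⟩

open scoped Classical in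
/-- **THE VALUATION OF THE ON-SHELL ATOM (NPB 961 Lemma 3.4 with footnote 23, read along rays, for the polynomial `V·z_e − S` of ЖЭТФ
§5.1)**: for every word and every real weight vector `y`,
`ord_y(V·z_e − S) = ord_y(V) + min_{(i,k) : photon i over lepton line k} max(y_{lep k}, 2·y_{lep k} − y_i)`
(= `ord_y(V) + min_i max(y′_i, 2y′_i − y_i)`, `y′_i = min_{l∈LPath(i)} y_l`, since `t ↦ max(t, 2t − c)` is increasing — the cell's
ORACLE-RULE (4c) / T1-EXPONENTS §2 L1 (b) closed form, there DERIVED and machine-checked, here a theorem).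
[cite: Volkov2020, §3.2 Lemma 3.4 (3.3) with footnote 23 («This inequality works in both directions too»), eq. (2.4) and §2.2.1; Volkov2016, §5.1 p.1174 (W = S − V z_e) and §5.2 p.1176 («W/V ≍ δ²»)] -/
theorem rayOrder_kirchhoff_mul_lineSum_sub_eq (hlep : ∀ k, E (lep k) = (Fin.castSucc k, Fin.succ k))
    (hinj : Function.Injective lep) (y : Fin N → ℝ) (hne : (overPairs E lep).Nonempty) :
    rayOrder (kirchhoffPolynomial ℝ E * lineSum ℝ (Finset.univ.image lep) - twoTreePolynomial ℝ E 0 (Fin.last V)) y =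
      rayOrder (kirchhoffPolynomial ℝ E) y +
        (overPairs E lep).inf' hne (fun p => max (y (lep p.2)) (2 * y (lep p.2) - y p.1)) := by
  set g : Fin N × Fin V → ℝ := fun p => max (y (lep p.2)) (2 * y (lep p.2) - y p.1) with hg
  have hconn := isConnectedEdgeList_of_word hlep
  have hmemQ : ∀ p, p ∈ overPairs E lep ↔ p.1 ∈ photons E lep ∧ Over E p.1 p.2 := mem_overPairs_iff
  -- upper bound: the minimising pair has a monomial below it
  obtain ⟨p₀, hp₀, hp₀eq⟩ := Finset.exists_mem_eq_inf' hne g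
  obtain ⟨d₀, hd₀, hd₀le⟩ := exists_mem_support_weight_le hlep hinj hconn 0 (Fin.last V) y ((hmemQ p₀).1 hp₀).1
    ((hmemQ p₀).1 hp₀).2
  have hne0 : kirchhoffPolynomial ℝ E * lineSum ℝ (Finset.univ.image lep) - twoTreePolynomial ℝ E 0 (Fin.last V) ≠ 0 :=
    ne_zero_iff.2 ⟨d₀, mem_support_iff.1 hd₀⟩
  rw [rayOrder_eq_inf' hne0]
  refine le_antisymm ((Finset.inf'_le _ hd₀).trans ?_) (Finset.le_inf' _ _ fun d hd => ?_)
  · rw [hp₀eq]; exact hd₀le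
  · obtain ⟨i, hi, k, hik, hle⟩ := exists_pair_le_weight_of_mem_support hlep hinj y hd
    have hpQ : (i, k) ∈ overPairs E lep := (hmemQ _).2 ⟨hi, hik⟩
    have := Finset.inf'_le g hpQ
    simp only [hg] at this
    linarith

/-- Same statement for `W = S − V·z_e` itself (`ord(−p) = ord(p)`). [cite: Volkov2020, §3.2 Lemma 3.4 with footnote 23; Volkov2016, §5.1 p.1174] -/
theorem rayOrder_wPolynomial_word_eq (hlep : ∀ k, E (lep k) = (Fin.castSucc k, Fin.succ k)) (hinj : Function.Injective lep)
    (y : Fin N → ℝ) (hne : (overPairs E lep).Nonempty) :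
    rayOrder (wPolynomial ℝ E 0 (Fin.last V) (Finset.univ.image lep)) y =
      rayOrder (kirchhoffPolynomial ℝ E) y +
        (overPairs E lep).inf' hne (fun p => max (y (lep p.2)) (2 * y (lep p.2) - y p.1)) := by
  rw [wPolynomial_eq_neg, rayOrder_neg]
  exact rayOrder_kirchhoff_mul_lineSum_sub_eq hlep hinj y hne

/-- The pair set is non-empty as soon as the word has a photon. [cite: Volkov2020, §2.1] -/
theorem overPairs_nonempty (hΦ : (photons E lep).Nonempty) : (overPairs E lep).Nonempty := by
  obtain ⟨i, hi⟩ := hΦ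
  obtain ⟨k, hk⟩ := exists_over_of_mem_photons hi
  exact ⟨(i, k), (mem_overPairs_iff _).2 ⟨hi, hk⟩⟩

/-- **Photon form of the upper bound** (the one-sided statement each photon gives, «Z ≤ Z_i ≤ Z₀»): for every photon `i` and every lepton
line `lep k` under it, `ord_y(V·z_e − S) ≤ ord_y(V) + max(y_{lep k}, 2y_{lep k} − y_i)`. [cite: Volkov2020, §3.2 Lemma 3.4 (3.3) and proof] -/
theorem rayOrder_sub_le_of_over (hlep : ∀ k, E (lep k) = (Fin.castSucc k, Fin.succ k)) (hinj : Function.Injective lep)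
    (y : Fin N → ℝ) {i : Fin N} (hi : i ∈ photons E lep) {k : Fin V} (hik : Over E i k) :
    rayOrder (kirchhoffPolynomial ℝ E * lineSum ℝ (Finset.univ.image lep) - twoTreePolynomial ℝ E 0 (Fin.last V)) y ≤
      rayOrder (kirchhoffPolynomial ℝ E) y + max (y (lep k)) (2 * y (lep k) - y i) := by
  classical
  obtain ⟨d, hd, hle⟩ := exists_mem_support_weight_le hlep hinj (isConnectedEdgeList_of_word hlep) 0 (Fin.last V) y hi hik
  have hne0 : kirchhoffPolynomial ℝ E * lineSum ℝ (Finset.univ.image lep) - twoTreePolynomial ℝ E 0 (Fin.last V) ≠ 0 :=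
    ne_zero_iff.2 ⟨d, mem_support_iff.1 hd⟩
  rw [rayOrder_eq_inf' hne0]
  exact (Finset.inf'_le _ hd).trans hle

end WordValuation

/-! ### Appended (g30, v3, theorems only): the photon form `min_i max(y′_i, 2y′_i − y_i)` with `y′_i = min_{l ∈ LPath(i)} y_l` -/

section WordPhotonForm

variable {lep : Fin V → Fin N}

/-- `LPath(i)` of a photon is non-empty. [cite: Volkov2020, §2.1 (LPath(i))] -/
theorem lPath_nonempty_of_mem_photons (hinj : Function.Injective lep) {i : Fin N} (hi : i ∈ photons E lep) :
    (lPath E lep i).Nonempty := by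
  obtain ⟨k, hk⟩ := exists_over_of_mem_photons hi
  exact ⟨lep k, (lep_mem_lPath_iff hinj i k).2 hk⟩

/-- A line of `LPath(e)` is `lep k` for some `k` under `e`. [cite: Volkov2020, §2.1 (LPath(i))] -/
theorem exists_eq_lep_of_mem_lPath {e l : Fin N} (hl : l ∈ lPath E lep e) : ∃ k : Fin V, Over E e k ∧ lep k = l := by
  unfold lPath at hl
  obtain ⟨k, hk, rfl⟩ := Finset.mem_image.1 hl
  exact ⟨k, (Finset.mem_filter.1 hk).2, rfl⟩

/-- **The pair minimum is the photon minimum**: `min_{(i,k)} max(y_{lep k}, 2y_{lep k} − y_i) = min_{i ∈ Ph} max(y′_i, 2y′_i − y_i)` with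
`y′_i = min_{l ∈ LPath(i)} y_l` (`z′_i = max_{l∈LPath(i)} z_l` of Lemma 3.4, along `z = δ^y`), because `t ↦ max(t, 2t − c)` is increasing.
The function `y′` is supplied by the caller together with the hypothesis that it IS that minimum on the photons.
[cite: Volkov2020, §3.2 Lemma 3.4 (3.3) (z′_i = max_{l∈LPath(i)} z_l)] -/
theorem inf'_overPairs_eq_inf'_photons (hinj : Function.Injective lep) (y y' : Fin N → ℝ) (hΦ : (photons E lep).Nonempty)
    (hy' : ∀ i ∈ photons E lep, ∀ h : (lPath E lep i).Nonempty, y' i = (lPath E lep i).inf' h y) :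
    (overPairs E lep).inf' (overPairs_nonempty hΦ) (fun p => max (y (lep p.2)) (2 * y (lep p.2) - y p.1)) =
      (photons E lep).inf' hΦ (fun i => max (y' i) (2 * y' i - y i)) := by
  refine le_antisymm (Finset.le_inf' _ _ fun i hi => ?_) (Finset.le_inf' _ _ fun p hp => ?_)
  · -- the photon minimum is attained at a pair
    have hne := lPath_nonempty_of_mem_photons hinj hi
    obtain ⟨l, hl, hleq⟩ := Finset.exists_mem_eq_inf' hne y
    obtain ⟨k, hk, rfl⟩ := exists_eq_lep_of_mem_lPath hl
    have hpair : (i, k) ∈ overPairs E lep := (mem_overPairs_iff _).2 ⟨hi, hk⟩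
    have h1 := Finset.inf'_le (fun p : Fin N × Fin V => max (y (lep p.2)) (2 * y (lep p.2) - y p.1)) hpair
    rw [hy' i hi hne, hleq]
    exact h1
  · -- every pair is bounded below by its photon's term
    obtain ⟨hi, hk⟩ := (mem_overPairs_iff p).1 hp
    have hne := lPath_nonempty_of_mem_photons hinj hi
    have hle : y' p.1 ≤ y (lep p.2) := by
      rw [hy' p.1 hi hne]
      exact Finset.inf'_le _ ((lep_mem_lPath_iff hinj p.1 p.2).2 hk)
    refine (Finset.inf'_le (fun i => max (y' i) (2 * y' i - y i)) hi).trans ?_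
    exact max_le_max hle (by linarith)

/-- **ORACLE-RULE (4c) / T1 L1 (b) verbatim**: for every self-energy word with a photon and every real ray `y`,
`ord_y(W) = ord_y(V) + min_{i ∈ Ph} max(y′_i, 2y′_i − y_i)`, `y′_i = min_{l ∈ LPath(i)} y_l` (`W = S − V·z_e`; the caller supplies `y′` with
the hypothesis that it is that minimum). [cite: Volkov2020, §3.2 Lemma 3.4 (3.3) with footnote 23, eq. (2.4); Volkov2016, §5.1 p.1174 and §5.2 p.1176 («W/V ≍ δ²»)] -/
theorem rayOrder_wPolynomial_word_eq_photons (hlep : ∀ k, E (lep k) = (Fin.castSucc k, Fin.succ k))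
    (hinj : Function.Injective lep) (y y' : Fin N → ℝ) (hΦ : (photons E lep).Nonempty)
    (hy' : ∀ i ∈ photons E lep, ∀ h : (lPath E lep i).Nonempty, y' i = (lPath E lep i).inf' h y) :
    rayOrder (wPolynomial ℝ E 0 (Fin.last V) (Finset.univ.image lep)) y =
      rayOrder (kirchhoffPolynomial ℝ E) y + (photons E lep).inf' hΦ (fun i => max (y' i) (2 * y' i - y i)) := by
  rw [rayOrder_wPolynomial_word_eq hlep hinj y (overPairs_nonempty hΦ), inf'_overPairs_eq_inf'_photons hinj y y' hΦ hy']

/-- The same for `V·z_e − S`. [cite: Volkov2020, §3.2 Lemma 3.4 (3.3) with footnote 23; Volkov2016, §5.1 p.1174] -/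
theorem rayOrder_kirchhoff_mul_lineSum_sub_eq_photons (hlep : ∀ k, E (lep k) = (Fin.castSucc k, Fin.succ k))
    (hinj : Function.Injective lep) (y y' : Fin N → ℝ) (hΦ : (photons E lep).Nonempty)
    (hy' : ∀ i ∈ photons E lep, ∀ h : (lPath E lep i).Nonempty, y' i = (lPath E lep i).inf' h y) :
    rayOrder (kirchhoffPolynomial ℝ E * lineSum ℝ (Finset.univ.image lep) - twoTreePolynomial ℝ E 0 (Fin.last V)) y =
      rayOrder (kirchhoffPolynomial ℝ E) y + (photons E lep).inf' hΦ (fun i => max (y' i) (2 * y' i - y i)) := by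
  rw [rayOrder_kirchhoff_mul_lineSum_sub_eq hlep hinj y (overPairs_nonempty hΦ), inf'_overPairs_eq_inf'_photons hinj y y' hΦ hy']

end WordPhotonForm

end Literature.MathematicalPhysics.QuantumFieldTheory.Volkov2016
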